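import Literature.Analysis.FluidPDE.TorusNSSobolevGrowthRate
import Literature.Analysis.FluidPDE.TorusClassicalNSMaximalSolution
import Literature.Analysis.FunctionSpaces.TorusHNegOnePairing
import Mathlib.Analysis.Normed.Ring.InfiniteSum
import HarnessLib

/-!
# The Wiener-algebra norm `F_0(u) = ∑_k ‖û(k)‖` blows up at least like `(ν/(T − t))^{1/2}` along
# Navier–Stokes flow on `T³` (Robinson–Sadowski–Silva 2012, Lemma 5.1, after Benameur 2010):
# the balance `d/dt F_0 + 4π²ν F_2 ≤ 2π F_0 F_1`, its cubic closure, and the necessary rate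

Search for candidate a priori estimates; no regularity claim.

Analysis/FluidPDE proof file (theorems only; no definitions, no named facts). Robinson, Sadowski
and Silva (J. Math. Phys. 53 (2012) 115618, §V.B) observe, following Benameur (J. Math. Anal.
Appl. 371 (2010) 719–727), that the "optimal" blow-up rate `t^{−1/2}` at the scaling level of
`Ḣ^{3/2}` — where the Sobolev energy method only gives `t^{−1/2+}` (§V.A, the tree's
`NSSobolev.hsSeminorm_sq_blowup_rate_three_halves`) — holds in the periodic case for the
Fourier–Wiener norm `‖u‖_{F_0} = ∑_k |û(k)|` (§III (3.1); `F_0 ⊂ L^∞`, (3.2)):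

  Lemma 5.1. There exists an absolute constant `c_{3/2}` such that
  `‖u(T − t)‖_{F_0(Q)} ≥ c_{3/2} t^{−1/2}`   (5.1)

(`T` the blow-up time, `ν = 1`). Printed proof: from the equations in Fourier variables,
`d/dt|û(k)| + |k|²|û(k)| ≤ |((u·∇)u)ˆ(k)|` (5.2) ("dividing by `|û(k)|` … can be made rigorous by
dividing instead by `(|û(k)|² + ε)^{1/2}` and letting `ε` tend to zero"); summing over `k`,
`d/dt‖u‖_{F_0} + ‖u‖_{F_2} ≤ ∑_{k,l}|û(k−l)||l||û(l)| ≤ ‖u‖_{F_0}‖u‖_{F_1} ≤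
‖u‖_{F_0}^{3/2}‖u‖_{F_2}^{1/2}` (interpolation (3.11)); Young's inequality gives
`d/dt‖u‖_{F_0} ≤ c‖u‖³_{F_0}`, "and (5.1) follows" (integration up to the blow-up time).

Here the argument is carried out on the unit torus `T^d`, `card d = 3`, for the tree's classical
solutions `Torus.IsClassicalNSSolutionOn` of the unforced system with mean-zero velocity slices,
in the tree's lattice normalisation: Mathlib's `UnitAddTorus.mFourierCoeff` with characters
`e^{2πik·x}`, `k ∈ ℤ^d` (so `∇ ↔ 2πik`, `Δ ↔ −4π²|k|²`, products ↔ plain lattice convolutions on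
the volume-one torus), `û(k) = mFourierCoeff (complexify ∘ u) k`, `|k| = (freqNormSq k)^{1/2}`:

  `F_0(u) = ∑_k ‖û(k)‖`,  `F_1(u) = ∑_k |k| ‖û(k)‖`,  `F_2(u) = ∑_k |k|² ‖û(k)‖`.

`F_0` has the Navier–Stokes scaling of `Ḣ^{3/2}(T³)` (one half-derivative above the enstrophy
level; `‖u‖_∞ ≤ F_0(u)`), and the viscosity and the constant are made explicit: the printed
"absolute constant" becomes `F_0(u(t)) ≥ (ν/(T−t))^{1/2}`.

* `NSWiener.norm_mFourierCoeff_convect_le_adv` — the convective term with the constant `2π` and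
  no dimensional factor: `‖𝓕((u·∇)v)(k)‖ ≤ 2π ∑_m ‖û(m)‖ |k−m| ‖v̂(k−m)‖` (RSS:
  `∑_k|((u·∇)u)ˆ(k)| ≤ ∑_{k,l}|û(k−l)||l||û(l)|`; the tree's
  `NSGevrey.norm_mFourierCoeff_convect_le` carries `(card d)`-dependent constants);
* `NSWiener.sq_tsum_sqrt_mul_le` — the interpolation `F_1² ≤ F_0 F_2` ((3.11) at `r = 1`);
* `NSWiener.hasDerivAt_tsum_regularisedWiener`, `NSWiener.tsum_regularisedWienerDeriv_le` — the
  regularised norm `G_ε = ∑_k √(‖û(k)‖² + ε²θ(k)²)` (`θ(k) = (1+|k|²)⁻³`; RSS's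
  "`(|û(k)|² + ε)^{1/2}`" with a summable profile so that the whole sum is differentiated at once)
  is differentiable in time termwise and obeys (5.2) summed:
  `G_ε' ≤ −4π²ν F_2 + 4π²νε∑|k|²θ + 2π F_0 F_1`;
* `NSWiener.integral_balance` — **(5.2) summed and integrated** (`ν ≥ 0`):
  `F_0(t₂) + 4π²ν ∫_{t₁}^{t₂} F_2 ≤ F_0(t₁) + 2π ∫_{t₁}^{t₂} F_0 F_1`;
* `NSWiener.wienerNorm_add_integral_le` — **the cubic differential inequality, integral form**
  (`ν > 0`): `F_0(t₂) + 2π²ν ∫_{t₁}^{t₂} F_2 ≤ F_0(t₁) + (2ν)⁻¹ ∫_{t₁}^{t₂} F_0³`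
  (`2πF_0F_1 ≤ 2πF_0^{3/2}F_2^{1/2} ≤ 2π²νF_2 + F_0³/(2ν)`);
* `Torus.wienerNorm_blowup_rate` — **Lemma 5.1 on `T³`**: a classical mean-zero solution on
  `[a, T) × T³` whose Wiener norm is unbounded on `[a, T)` has `F_0(u(t)) ≥ (ν/(T − t))^{1/2}` for
  all `t ∈ [a, T)` (comparison of the integral inequality with the explicit solution
  `z(s) = (m⁻² − (s−t)/ν)^{−1/2}` of `ż = z³/(2ν)` by a first-crossing argument — `F_0` is only
  continuous, so the printed "divide by `‖u‖³_{F_0}` and integrate" is done on the comparison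
  solution);
* `Torus.classicalNS_continuation_of_bddAbove_wienerNorm`,
  `Torus.not_bddAbove_wienerNorm_of_not_bddAbove_gradNormSq`,
  `Torus.wienerNorm_blowup_rate_of_not_bddAbove_gradNormSq` — a bounded Wiener norm continues the
  solution (`‖u‖_∞ ≤ F_0(u)`, RSS (3.2), and Serrin's `L²_t L^∞_x` door
  `Torus.classicalNS_continuation_of_velocitySup_sq_integral_le`), so the rate holds with blow-up
  read off the enstrophy;
* `Torus.classicalNS_continuation_of_wienerNorm_lifespan` — **the lifespan bound**
  `T_* ≥ ν/F_0(u(0))²` (RSS p. 115618-12: "a lower bound on the existence time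
  `T ∼ ‖û₀‖_{ℓ¹}^{−2}`"): `T·F_0(u(0))² < ν` ⇒ continuation past `T`.

For the functional-mining cell: a NECESSARY blow-up rate for an `Ḣ^{3/2}`-level `ℓ¹`-Fourier
functional with explicit constant `√ν` and exponent exactly `1/2` — the Wiener-algebra companion
of the tree's `L^q` (Leray), `Ḣ^s` (`1/2 < s < 3/2`, `s > 5/2`, borderline `3/2⁺`, `5/2`) and
`‖∇u‖₂²` rates; it constrains extreme-growth scenarios (any blow-up must have
`∑‖û(k)‖ ≳ (ν/(T−t))^{1/2}`) and says nothing about large-data regularity. What is NOT typed: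
the whole-space version via the mild formulation (RSS p. 115618-12), Benameur's original `ℝ³`
theorem, rough (non-classical) solutions.

## Mathlib / tree search

Tree: `NSSobolev.mFourierCoeff_convect_apply_eq_tsum`, `NSGevrey.summable_convectMajorant`,
`NSGevrey.norm_sum_intCast_mul_apply_le`, `NSSobolev.exists_forall_pow_four_mul_norm_sq_le`
(`TorusNSSobolevCommutator/GevreySums/GrowthRate`),
`NSGevrey.hasDerivWithinAt_norm_sq_mFourierCoeff`, `hasDerivWithinAt_mFourierCoeff_complexify`,
`Torus.IsClassicalNSSolutionOn.re_inner_mFourierCoeff_timeDerivWithin`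
(`TorusNSGevreyCoefficients`), `Torus.norm_le_tsum_norm_mFourierCoeff` (`TorusAgmonExplicit`),
`Torus.mFourierCoeff_complexify_zero_of_hasZeroMean` (`TorusHNegOnePairing`),
`Torus.summable_one_add_freqNormSq_rpow_neg` (`TorusInverseLaplacianSup`),
`Torus.classicalNS_continuation_of_velocitySup_sq_integral_le` (`TorusNSEnstrophyContinuation`);
the pattern of `Torus.lqNorm_blowup_rate` / `Torus.not_bddAbove_lqNorm_of_not_bddAbove_gradNormSq`
(`TorusNSLebesgueNormGrowthRate`, `TorusNSSobolevBlowupRate`); Mathlib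
`hasDerivAt_tsum_of_isPreconnected`, `continuousOn_tsum`, `tsum_mul_tsum_of_summable_norm`,
`Summable.tsum_prod`, `intervalIntegral.integral_eq_sub_of_hasDerivAt(_of_le)`,
`Finset.sum_mul_sq_le_sq_mul_sq`, `HasDerivAt.sqrt/.inv`, `IsCompact.bddAbove_image`.
Searched `blowup_rate|wienerNorm|F_0|Benameur|Lemma 5.1`: the tree types RSS 2012 §IV–§VI for the
`Ḣ^s` scale (`TorusNSSobolevBlowupRate`, `TorusNSSobolevHighRange`, `TorusNSSobolevLifespan`)
but not §V.B; no `ℓ¹`-Fourier blow-up rate for Navier–Stokes in the tree. The private lattice /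
regularisation devices are those of `TorusNSLeiLinCriterion` (Lei–Lin 2011), copied rather than
imported (weight `1` instead of `|k|⁻¹`; the zero mode of `∂ₜu` handled by the mean-zero slices).

## References

* J. C. Robinson, W. Sadowski, R. P. Silva, *Lower bounds on blow up solutions of the
  three-dimensional Navier–Stokes equations in homogeneous Sobolev spaces*, J. Math. Phys. 53
  (2012) 115618, §III (3.1)–(3.2), (3.11) (pp. 115618-6, -9), §V.B Lemma 5.1, (5.1)–(5.2)
  (p. 115618-11) (held: paper:doi-10-1063-1-4762841, PDF pp. 7, 10, 12).
  [RobinsonSadowskiSilva2012]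
* J. Benameur, *On the blow-up criterion of 3D Navier–Stokes equations*, J. Math. Anal. Appl.
  371 (2010) 719–727 (the whole-space antecedent, as cited by RSS).
* J. C. Robinson, J. L. Rodrigo, W. Sadowski, *The three-dimensional Navier–Stokes equations*,
  CUP 2016, Thm 8.17 with Lemma 8.16 (Serrin's condition, `r = 2`, `s = ∞`).
  [RobinsonRodrigoSadowskiCUP2016]
-/

noncomputable section

open MeasureTheory Set Filter UnitAddTorus Function Finset
open scoped Topology BigOperators InnerProductSpace ComplexConjugate

namespace Literature.Analysis.FluidPDE

namespace NSWiener

open Literature.Analysis.FunctionSpaces Literature.Analysis.FunctionSpaces.Torus NSGevrey NSSobolev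

variable {d : Type*} [Fintype d] [DecidableEq d]

/-! ### §1 Lattice lemmas: the advective convolution bound with constant `2π`, the Wiener algebra -/

section Lattice

variable {u v : UnitAddTorus d → EuclideanSpace ℝ d}

omit [DecidableEq d] in
/-- Cauchy–Schwarz on the lattice: `‖∑_j k_j z_j‖ ≤ |k| ‖z‖` (`|k| = (freqNormSq k)^{1/2}`).
[folklore] -/
private theorem norm_sum_intCast_mul_apply_le (k : d → ℤ) (z : EuclideanSpace ℂ d) :
    ‖∑ j, ((k j : ℤ) : ℂ) * z j‖ ≤ Real.sqrt (freqNormSq k) * ‖z‖ := by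
  have h1 : ‖∑ j, ((k j : ℤ) : ℂ) * z j‖ ≤ ∑ j, |(k j : ℝ)| * ‖z j‖ := by
    refine (norm_sum_le _ _).trans (le_of_eq (Finset.sum_congr rfl fun j _ => ?_))
    rw [norm_mul, Complex.norm_intCast]
  have h2 : (∑ j, |(k j : ℝ)| * ‖z j‖) ^ 2 ≤ freqNormSq k * ‖z‖ ^ 2 := by
    have hcs := Finset.sum_mul_sq_le_sq_mul_sq (Finset.univ : Finset d)
      (fun j => |(k j : ℝ)|) (fun j => ‖z j‖)
    have hz : ‖z‖ ^ 2 = ∑ j, ‖z j‖ ^ 2 := by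
      rw [EuclideanSpace.norm_eq, Real.sq_sqrt (Finset.sum_nonneg fun j _ => sq_nonneg _)]
    have hk : freqNormSq k = ∑ j, |(k j : ℝ)| ^ 2 := by
      simp only [freqNormSq, sq_abs]
    rw [hz, hk]
    exact hcs
  have h3 : 0 ≤ ∑ j, |(k j : ℝ)| * ‖z j‖ :=
    Finset.sum_nonneg fun j _ => mul_nonneg (abs_nonneg _) (norm_nonneg _)
  have h4 : ∑ j, |(k j : ℝ)| * ‖z j‖ ≤ Real.sqrt (freqNormSq k) * ‖z‖ := by
    rw [← Real.sqrt_sq h3, ← Real.sqrt_sq (norm_nonneg z), ← Real.sqrt_mul (freqNormSq_nonneg k)]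
    exact Real.sqrt_le_sqrt h2
  exact h1.trans h4


/-- **The convective term in Fourier variables, advective form with the sharp constant**
(Robinson–Sadowski–Silva 2012, proof of Lemma 5.1:
`∑_k |((u·∇)u)ˆ(k)| ≤ ∑_{k,l} |û(k−l)| |l| |û(l)|`):
for smooth real fields `u, v` on `T^n` and every frequency `k`,
`‖𝓕(complexify ∘ (u·∇)v)(k)‖ ≤ 2π ∑_m ‖û(m)‖ |k − m| ‖v̂(k − m)‖`
(componentwise `𝓕((u·∇)v)_p(k) = ∑_m (2πi (k−m)·û(m)) v̂_p(k−m)`,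
`NSSobolev.mFourierCoeff_convect_apply_eq_tsum`, and `|(k−m)·û(m)| ≤ |k−m| ‖û(m)‖` by Cauchy–Schwarz
— no dimensional constant, unlike `NSGevrey.norm_mFourierCoeff_convect_le`).
[cite: RobinsonSadowskiSilva2012, §V.B, proof of Lemma 5.1 (display after (5.2))] -/
theorem norm_mFourierCoeff_convect_le_adv (hu : IsSmooth u) (hv : IsSmooth v) (k : d → ℤ) :
    ‖mFourierCoeff (EuclideanSpace.complexify ∘ Torus.convect u v) k‖ ≤
      2 * Real.pi * ∑' m : d → ℤ, ‖mFourierCoeff (EuclideanSpace.complexify ∘ u) m‖ *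
        (Real.sqrt (freqNormSq (k - m)) *
          ‖mFourierCoeff (EuclideanSpace.complexify ∘ v) (k - m)‖) := by
  classical
  set U : (d → ℤ) → EuclideanSpace ℂ d := fun m => mFourierCoeff (EuclideanSpace.complexify ∘ u) m
    with hU
  set V : (d → ℤ) → EuclideanSpace ℂ d := fun m => mFourierCoeff (EuclideanSpace.complexify ∘ v) m
    with hV
  set c : (d → ℤ) → ℂ := fun m => 2 * Real.pi * Complex.I * ∑ j, (((k - m) j : ℤ) : ℂ) * U m j
    with hc
  have hc_le : ∀ m, ‖c m‖ ≤ 2 * Real.pi * (Real.sqrt (freqNormSq (k - m)) * ‖U m‖) := by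
    intro m
    rw [hc, norm_mul]
    have : ‖(2 * Real.pi * Complex.I : ℂ)‖ = 2 * Real.pi := by simp [abs_of_pos Real.pi_pos]
    rw [this]
    exact mul_le_mul_of_nonneg_left (norm_sum_intCast_mul_apply_le (k - m) (U m)) (by positivity)
  have hS : Summable fun m : d → ℤ => ‖U m‖ * (Real.sqrt (freqNormSq (k - m)) * ‖V (k - m)‖) :=
    summable_convectMajorant hu hv k
  have hF : Summable fun m : d → ℤ => ‖c m • V (k - m)‖ := by
    refine (hS.mul_left (2 * Real.pi)).of_nonneg_of_le (fun m => norm_nonneg _) fun m => ?_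
    rw [norm_smul]
    calc ‖c m‖ * ‖V (k - m)‖
        ≤ 2 * Real.pi * (Real.sqrt (freqNormSq (k - m)) * ‖U m‖) * ‖V (k - m)‖ :=
          mul_le_mul_of_nonneg_right (hc_le m) (norm_nonneg _)
      _ = 2 * Real.pi * (‖U m‖ * (Real.sqrt (freqNormSq (k - m)) * ‖V (k - m)‖)) := by ring
  have hFs : Summable fun m : d → ℤ => c m • V (k - m) := hF.of_norm
  have hvec : mFourierCoeff (EuclideanSpace.complexify ∘ Torus.convect u v) k =
      ∑' m : d → ℤ, c m • V (k - m) := by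
    have e1 : ∀ p, (∑' m : d → ℤ, c m • V (k - m)) p = ∑' m : d → ℤ, c m * V (k - m) p := by
      intro p
      have hp := (EuclideanSpace.proj p : EuclideanSpace ℂ d →L[ℂ] ℂ).map_tsum hFs
      simpa using hp
    ext p
    rw [e1 p, mFourierCoeff_convect_apply_eq_tsum hu hv k p]
  rw [hvec]
  calc ‖∑' m : d → ℤ, c m • V (k - m)‖
      ≤ ∑' m : d → ℤ, ‖c m • V (k - m)‖ := norm_tsum_le_tsum_norm hF
    _ ≤ ∑' m : d → ℤ, 2 * Real.pi * (‖U m‖ * (Real.sqrt (freqNormSq (k - m)) * ‖V (k - m)‖)) := by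
        refine hF.tsum_le_tsum (fun m => ?_) (hS.mul_left _)
        rw [norm_smul]
        calc ‖c m‖ * ‖V (k - m)‖
            ≤ 2 * Real.pi * (Real.sqrt (freqNormSq (k - m)) * ‖U m‖) * ‖V (k - m)‖ :=
              mul_le_mul_of_nonneg_right (hc_le m) (norm_nonneg _)
          _ = _ := by ring
    _ = 2 * Real.pi * ∑' m : d → ℤ, ‖U m‖ * (Real.sqrt (freqNormSq (k - m)) * ‖V (k - m)‖) :=
        tsum_mul_left

omit [Fintype d] [DecidableEq d] in
/-- **The Wiener algebra on the lattice, two families** (Fubini and translation invariance): for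
nonnegative summable `a, b : ℤ^n → ℝ`, every fibre `m ↦ a(m) b(k − m)` is summable, the fibre sums
are summable in `k`, and `∑_k ∑_m a(m) b(k − m) = (∑ a)(∑ b)`
(`‖u‖_{F_0}‖u‖_{F_1}` in Robinson–Sadowski–Silva's proof of Lemma 5.1). [folklore] -/
private theorem tsum_tsum_mul_mul_sub {a b : (d → ℤ) → ℝ} (ha0 : ∀ k, 0 ≤ a k) (hb0 : ∀ k, 0 ≤ b k)
    (ha : Summable a) (hb : Summable b) :
    (∀ k, Summable fun m => a m * b (k - m)) ∧
    (Summable fun k => ∑' m, a m * b (k - m)) ∧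
    ∑' k, ∑' m, a m * b (k - m) = (∑' k, a k) * (∑' k, b k) := by
  have han : Summable fun k => ‖a k‖ := by
    refine ha.congr fun k => ?_
    rw [Real.norm_eq_abs, abs_of_nonneg (ha0 k)]
  have hbn : Summable fun k => ‖b k‖ := by
    refine hb.congr fun k => ?_
    rw [Real.norm_eq_abs, abs_of_nonneg (hb0 k)]
  have hP : Summable fun z : (d → ℤ) × (d → ℤ) => a z.1 * b z.2 :=
    summable_mul_of_summable_norm han hbn
  have hPeq : (∑' k, a k) * (∑' k, b k) = ∑' z : (d → ℤ) × (d → ℤ), a z.1 * b z.2 :=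
    tsum_mul_tsum_of_summable_norm han hbn
  let e : (d → ℤ) × (d → ℤ) ≃ (d → ℤ) × (d → ℤ) :=
    { toFun := fun z => (z.2, z.1 - z.2)
      invFun := fun w => (w.1 + w.2, w.1)
      left_inv := fun z => by simp
      right_inv := fun w => by simp }
  have hQ : Summable fun z : (d → ℤ) × (d → ℤ) => a z.2 * b (z.1 - z.2) :=
    (e.summable_iff (f := fun w : (d → ℤ) × (d → ℤ) => a w.1 * b w.2)).2 hP
  have hQeq : ∑' z : (d → ℤ) × (d → ℤ), a z.2 * b (z.1 - z.2) =
      ∑' w : (d → ℤ) × (d → ℤ), a w.1 * b w.2 :=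
    e.tsum_eq (fun w : (d → ℤ) × (d → ℤ) => a w.1 * b w.2)
  refine ⟨fun k => hQ.prod_factor k, hQ.prod, ?_⟩
  rw [← hQ.tsum_prod, hQeq, ← hPeq]

omit [DecidableEq d] in
/-- **Interpolation `F_1² ≤ F_0 F_2`** (Cauchy–Schwarz; Robinson–Sadowski–Silva (3.11) at `r = 1`):
for a nonnegative `a : ℤ^n → ℝ` with summable weighted families,
`(∑_k |k| a(k))² ≤ (∑_k a(k)) (∑_k |k|² a(k))` (`|k| = (freqNormSq k)^{1/2}`).
[cite: RobinsonSadowskiSilva2012, §III (3.11)] -/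
theorem sq_tsum_sqrt_mul_le {a : (d → ℤ) → ℝ} (ha0 : ∀ k, 0 ≤ a k) (h0 : Summable a)
    (h1 : Summable fun k => Real.sqrt (freqNormSq k) * a k)
    (h2 : Summable fun k => freqNormSq k * a k) :
    (∑' k, Real.sqrt (freqNormSq k) * a k) ^ 2 ≤ (∑' k, a k) * (∑' k, freqNormSq k * a k) := by
  classical
  set P : ℝ := ∑' k, a k with hPdef
  set Q : ℝ := ∑' k, freqNormSq k * a k with hQdef
  have hq0 : ∀ k, 0 ≤ freqNormSq k * a k := fun k => mul_nonneg (freqNormSq_nonneg k) (ha0 k)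
  have hr0 : ∀ k, 0 ≤ Real.sqrt (freqNormSq k) * a k := fun k =>
    mul_nonneg (Real.sqrt_nonneg _) (ha0 k)
  have hP0 : 0 ≤ P := tsum_nonneg ha0
  have hQ0 : 0 ≤ Q := tsum_nonneg hq0
  have hfg : ∀ k, Real.sqrt (a k) * Real.sqrt (freqNormSq k * a k) =
      Real.sqrt (freqNormSq k) * a k := by
    intro k
    rw [← Real.sqrt_mul (ha0 k), show a k * (freqNormSq k * a k) = freqNormSq k * a k ^ 2 by ring,
      Real.sqrt_mul (freqNormSq_nonneg k), Real.sqrt_sq (ha0 k)]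
  have hK : ∀ K : Finset (d → ℤ), ∑ k ∈ K, Real.sqrt (freqNormSq k) * a k ≤ Real.sqrt (P * Q) := by
    intro K
    have hcs := Finset.sum_mul_sq_le_sq_mul_sq K (fun k => Real.sqrt (a k))
      (fun k => Real.sqrt (freqNormSq k * a k))
    simp only [hfg, Real.sq_sqrt (ha0 _), Real.sq_sqrt (hq0 _)] at hcs
    have ha' : ∑ k ∈ K, a k ≤ P := h0.sum_le_tsum K fun k _ => ha0 k
    have hb' : ∑ k ∈ K, freqNormSq k * a k ≤ Q := h2.sum_le_tsum K fun k _ => hq0 k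
    have h3 : (∑ k ∈ K, Real.sqrt (freqNormSq k) * a k) ^ 2 ≤ P * Q :=
      hcs.trans (mul_le_mul ha' hb' (Finset.sum_nonneg fun k _ => hq0 k) hP0)
    calc ∑ k ∈ K, Real.sqrt (freqNormSq k) * a k ≤ |∑ k ∈ K, Real.sqrt (freqNormSq k) * a k| :=
          le_abs_self _
      _ = Real.sqrt ((∑ k ∈ K, Real.sqrt (freqNormSq k) * a k) ^ 2) := (Real.sqrt_sq_eq_abs _).symm
      _ ≤ Real.sqrt (P * Q) := Real.sqrt_le_sqrt h3
  have hle : ∑' k, Real.sqrt (freqNormSq k) * a k ≤ Real.sqrt (P * Q) := h1.tsum_le_of_sum_le hK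
  have h0' : 0 ≤ ∑' k, Real.sqrt (freqNormSq k) * a k := tsum_nonneg hr0
  calc (∑' k, Real.sqrt (freqNormSq k) * a k) ^ 2
      ≤ Real.sqrt (P * Q) ^ 2 := pow_le_pow_left₀ h0' hle 2
    _ = P * Q := Real.sq_sqrt (mul_nonneg hP0 hQ0)

end Lattice

/-! ### §2 Weighted coefficient sums; uniform control on a time window -/

section Weights

omit [DecidableEq d] in
/-- `|k| ≤ 1 + |k|²`. [folklore] -/
private theorem sqrt_freqNormSq_le_one_add (k : d → ℤ) :
    Real.sqrt (freqNormSq k) ≤ 1 + freqNormSq k := by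
  have h0 := freqNormSq_nonneg k
  rcases le_total (freqNormSq k) 1 with h | h
  · calc Real.sqrt (freqNormSq k) ≤ Real.sqrt 1 := Real.sqrt_le_sqrt h
      _ = 1 := Real.sqrt_one
      _ ≤ 1 + freqNormSq k := by linarith
  · calc Real.sqrt (freqNormSq k) ≤ freqNormSq k := by
          rw [Real.sqrt_le_left (by linarith)]
          nlinarith
      _ ≤ 1 + freqNormSq k := by linarith

omit [DecidableEq d] in
/-- The punctured lattice `p`-series `∑_{k≠0} |k|^{-2t}` converges for `2t > n`
(`|k|^{-2t} ≤ 2^t (1+|k|²)^{-t}` off the origin). [folklore] -/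
private theorem summable_ite_freqNormSq_rpow_neg {t : ℝ} (ht : (Fintype.card d : ℝ) < 2 * t) :
    Summable fun k : d → ℤ => if k = 0 then (0 : ℝ) else freqNormSq k ^ (-t) := by
  classical
  have ht0 : 0 ≤ t := by
    have : (0 : ℝ) ≤ Fintype.card d := Nat.cast_nonneg _
    linarith
  rcases isEmpty_or_nonempty d with hd | hd
  · refine summable_of_ne_finset_zero (s := ∅) fun k _ => ?_
    rw [if_pos (Subsingleton.elim k 0)]
  have hmaj := (summable_one_add_freqNormSq_rpow_neg (d := d) ht).mul_left ((2 : ℝ) ^ t)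
  refine Summable.of_nonneg_of_le (fun k => ?_) (fun k => ?_) hmaj
  · split_ifs
    · exact le_rfl
    · exact Real.rpow_nonneg (freqNormSq_nonneg k) _
  · split_ifs with hk
    · exact mul_nonneg (Real.rpow_nonneg (by norm_num) _)
        (Real.rpow_nonneg (by linarith [freqNormSq_nonneg k]) _)
    · have hm : 1 ≤ freqNormSq k := one_le_freqNormSq_of_ne_zero hk
      have hm0 : 0 < freqNormSq k := by linarith
      have h2 : (freqNormSq k)⁻¹ ≤ 2 / (1 + freqNormSq k) := by
        rw [inv_eq_one_div, div_le_div_iff₀ hm0 (by linarith)]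
        linarith
      calc freqNormSq k ^ (-t) = (freqNormSq k)⁻¹ ^ t := by
            rw [Real.rpow_neg hm0.le, Real.inv_rpow hm0.le]
        _ ≤ (2 / (1 + freqNormSq k)) ^ t := Real.rpow_le_rpow (inv_nonneg.2 hm0.le) h2 ht0
        _ = 2 ^ t * (1 + freqNormSq k) ^ (-t) := by
            rw [Real.div_rpow (by norm_num) (by linarith), Real.rpow_neg (by linarith),
              div_eq_mul_inv]

variable {v : UnitAddTorus d → EuclideanSpace ℝ d}

/-- **Fixed-time summability**: for a smooth field and any weight `|φ(k)| ≤ 1 + |k|²` the family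
`φ(k)‖v̂(k)‖` is summable (rapid decay of the coefficients). [folklore] -/
private theorem summable_weight_mul_norm (hv : IsSmooth v) {φ : (d → ℤ) → ℝ}
    (hφ : ∀ k, |φ k| ≤ 1 + freqNormSq k) :
    Summable fun k => φ k * ‖mFourierCoeff (EuclideanSpace.complexify ∘ v) k‖ := by
  have hs := hv.complexify_comp.rapidDecay_mFourierCoeff 1
  simp only [pow_one] at hs
  refine Summable.of_norm_bounded hs fun k => ?_
  rw [norm_mul, norm_norm, Real.norm_eq_abs]
  exact mul_le_mul_of_nonneg_right (hφ k) (norm_nonneg _)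

/-- Summability of `|k| ‖v̂(k)‖`. [folklore] -/
private theorem summable_sqrt_mul_norm (hv : IsSmooth v) :
    Summable fun k => Real.sqrt (freqNormSq k) *
      ‖mFourierCoeff (EuclideanSpace.complexify ∘ v) k‖ :=
  summable_weight_mul_norm hv fun k => by
    rw [abs_of_nonneg (Real.sqrt_nonneg _)]; exact sqrt_freqNormSq_le_one_add k

/-- Summability of `‖v̂(k)‖`. [folklore] -/
private theorem summable_norm (hv : IsSmooth v) :
    Summable fun k => ‖mFourierCoeff (EuclideanSpace.complexify ∘ v) k‖ :=
  (hv.complexify_comp.rapidDecay_mFourierCoeff).summable_norm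


omit [Fintype d] [DecidableEq d] in
/-- From `x³ n ≤ C` (`x ≥ 1`) to `x · n ≤ C x^{−2}`. [folklore] -/
private theorem mul_le_of_cube_mul_le {x n C : ℝ} (hx : 1 ≤ x) (h : x ^ 3 * n ≤ C) :
    x * n ≤ C * x ^ (-(2 : ℝ)) := by
  have hx0 : 0 < x := by linarith
  have e : x = x ^ (-(2 : ℝ)) * x ^ 3 := by
    rw [← Real.rpow_natCast x 3, ← Real.rpow_add hx0]
    norm_num
  calc x * n = (x ^ (-(2 : ℝ)) * x ^ 3) * n := by rw [← e]
    _ = x ^ (-(2 : ℝ)) * (x ^ 3 * n) := by ring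
    _ ≤ x ^ (-(2 : ℝ)) * C := mul_le_mul_of_nonneg_left h (Real.rpow_nonneg hx0.le _)
    _ = C * x ^ (-(2 : ℝ)) := mul_comm _ _

omit [Fintype d] [DecidableEq d] in
/-- From `x³ n ≤ C` (`x ≥ 1`) to `n ≤ C x^{−3}`. [folklore] -/
private theorem le_of_cube_mul_le {x n C : ℝ} (hx : 1 ≤ x) (h : x ^ 3 * n ≤ C) :
    n ≤ C * x ^ (-(3 : ℝ)) := by
  have hx0 : 0 < x := by linarith
  have hx3 : 0 < x ^ 3 := pow_pos hx0 3
  have e : x ^ (-(3 : ℝ)) = (x ^ 3)⁻¹ := by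
    rw [Real.rpow_neg hx0.le, show (3 : ℝ) = ((3 : ℕ) : ℝ) by norm_num, Real.rpow_natCast]
  rw [e, ← div_eq_mul_inv, le_div_iff₀ hx3]
  linarith [mul_comm (x ^ 3) n]

omit [DecidableEq d] in
/-- `∑_k |k|² θ(k)` converges for `θ(k) = (1 + |k|²)⁻³` on `ℤ³` (`|k|²θ(k) ≤ (1+|k|²)⁻²`).
[folklore] -/
private theorem summable_freqNormSq_mul_theta (hd : Fintype.card d = 3) :
    Summable fun k : d → ℤ => freqNormSq k * ((1 + freqNormSq k) ^ 3)⁻¹ := by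
  haveI : Nonempty d := Fintype.card_pos_iff.1 (by rw [hd]; norm_num)
  have hs := summable_one_add_freqNormSq_rpow_neg (d := d) (s := 2) (by rw [hd]; norm_num)
  refine Summable.of_nonneg_of_le (fun k => mul_nonneg (freqNormSq_nonneg _)
    (inv_nonneg.2 (pow_nonneg (by linarith [freqNormSq_nonneg k]) 3))) (fun k => ?_) hs
  have h1 : (0 : ℝ) < 1 + freqNormSq k := by linarith [freqNormSq_nonneg k]
  have e : (1 + freqNormSq k) ^ (-(2 : ℝ)) = (1 + freqNormSq k) * ((1 + freqNormSq k) ^ 3)⁻¹ := by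
    rw [Real.rpow_neg h1.le, show (2 : ℝ) = ((2 : ℕ) : ℝ) by norm_num, Real.rpow_natCast]
    field_simp
  rw [e]
  exact mul_le_mul_of_nonneg_right (by linarith [freqNormSq_nonneg k])
    (inv_nonneg.2 (pow_nonneg h1.le 3))

omit [DecidableEq d] in
/-- `∑_k θ(k)` converges. [folklore] -/
private theorem summable_theta (hd : Fintype.card d = 3) :
    Summable fun k : d → ℤ => ((1 + freqNormSq k) ^ 3)⁻¹ := by
  haveI : Nonempty d := Fintype.card_pos_iff.1 (by rw [hd]; norm_num)
  have hs := summable_one_add_freqNormSq_rpow_neg (d := d) (s := 2) (by rw [hd]; norm_num)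
  refine Summable.of_nonneg_of_le
    (fun k => inv_nonneg.2 (pow_nonneg (by linarith [freqNormSq_nonneg k]) 3)) (fun k => ?_) hs
  have h1 : (1 : ℝ) ≤ 1 + freqNormSq k := by linarith [freqNormSq_nonneg k]
  have h1' : (0 : ℝ) < 1 + freqNormSq k := by linarith
  have e : (1 + freqNormSq k) ^ (-(2 : ℝ)) = ((1 + freqNormSq k) ^ 2)⁻¹ := by
    rw [Real.rpow_neg h1'.le, show (2 : ℝ) = ((2 : ℕ) : ℝ) by norm_num, Real.rpow_natCast]
  rw [e]
  exact inv_anti₀ (pow_pos h1' 2) (pow_le_pow_right₀ h1 (by norm_num))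

/-- Summability of `|k|² ‖v̂(k)‖`. [folklore] -/
private theorem summable_freqNormSq_mul_norm (hv : IsSmooth v) :
    Summable fun k => freqNormSq k * ‖mFourierCoeff (EuclideanSpace.complexify ∘ v) k‖ :=
  summable_weight_mul_norm hv fun k => by
    rw [abs_of_nonneg (freqNormSq_nonneg _)]; linarith [freqNormSq_nonneg k]

end Weights

section Window

variable {a b : ℝ} {w : ℝ → UnitAddTorus d → EuclideanSpace ℝ d}

/-- **Uniform decay on a compact time window**: for `w` jointly smooth on `[a, b] × T^n` there is
`C ≥ 0` with `|k|⁶ ‖ŵ(τ, k)‖ ≤ C` for all `τ ∈ [a, b]` and all `k` (the uniform `H⁴` bound of the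
window applied to `Δw`, `NSSobolev.exists_forall_pow_four_mul_norm_sq_le`). [folklore] -/
private theorem exists_forall_freqNormSq_cube_mul_norm_le (hab : a < b)
    (hw : Torus.IsSmoothSpaceTimeOn (Icc a b) w) :
    ∃ C : ℝ, 0 ≤ C ∧ ∀ τ ∈ Icc a b, ∀ k : d → ℤ,
      freqNormSq k ^ 3 * ‖mFourierCoeff (EuclideanSpace.complexify ∘ w τ) k‖ ≤ C := by
  have hU : UniqueDiffOn ℝ (Icc a b) := uniqueDiffOn_Icc hab
  have hL : Torus.IsSmoothSpaceTimeOn (Icc a b) (fun τ => Torus.laplacian (w τ)) :=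
    hw.laplacian hU
  obtain ⟨W, hW0, hW⟩ := exists_forall_pow_four_mul_norm_sq_le hab hL
  refine ⟨Real.sqrt W / (4 * Real.pi ^ 2), by positivity, fun τ hτ k => ?_⟩
  have hwt : IsSmooth (w τ) := hw.isSmooth_slice hτ
  have h1 := hW τ hτ k
  rw [mFourierCoeff_complexify_laplacian hwt, norm_neg, norm_smul, Complex.norm_real,
    Real.norm_eq_abs, abs_of_nonneg (by have := freqNormSq_nonneg k; positivity)] at h1
  rw [le_div_iff₀ (by positivity)]
  have hx : 0 ≤ freqNormSq k ^ 3 * ‖mFourierCoeff (EuclideanSpace.complexify ∘ w τ) k‖ *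
      (4 * Real.pi ^ 2) := by have := freqNormSq_nonneg k; positivity
  refine (Real.le_sqrt hx hW0).2 (le_trans (le_of_eq ?_) h1)
  ring

omit [DecidableEq d] in
/-- The slice coefficients of a jointly smooth field are continuous in time on the window.
[folklore] -/
private theorem continuousOn_mFourierCoeff (hab : a < b)
    (hw : Torus.IsSmoothSpaceTimeOn (Icc a b) w) (k : d → ℤ) :
    ContinuousOn (fun τ => mFourierCoeff (EuclideanSpace.complexify ∘ w τ) k) (Icc a b) :=
  fun _ hτ => (hasDerivWithinAt_mFourierCoeff_complexify hw (convex_Icc a b)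
    (uniqueDiffOn_Icc hab) hτ k).continuousWithinAt

/-- **Continuity in time of the weighted Wiener sums** `τ ↦ ∑_k φ(k) ‖ŵ(τ,k)‖` on a compact
window of `T³`, for a jointly smooth field with mean-zero slices and any weight with `|φ(k)| ≤ |k|²`
off the origin (covers `1, |k|, |k|²`; `continuousOn_tsum` with the majorant `C |k|^{−4}` of the
uniform decay). [folklore] -/
private theorem continuousOn_tsum_weight_mul_norm (hd : Fintype.card d = 3) (hab : a < b)
    (hw : Torus.IsSmoothSpaceTimeOn (Icc a b) w) (hmean : ∀ τ ∈ Icc a b, Torus.HasZeroMean (w τ))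
    {φ : (d → ℤ) → ℝ} (hφ : ∀ k, k ≠ 0 → |φ k| ≤ freqNormSq k) :
    ContinuousOn (fun τ => ∑' k : d → ℤ,
      φ k * ‖mFourierCoeff (EuclideanSpace.complexify ∘ w τ) k‖) (Icc a b) := by
  classical
  obtain ⟨C, hC0, hC⟩ := exists_forall_freqNormSq_cube_mul_norm_le hab hw
  set M : (d → ℤ) → ℝ := fun k =>
    C * (if k = 0 then (0 : ℝ) else freqNormSq k ^ (-(2 : ℝ))) with hM
  have hMs : Summable M :=
    (summable_ite_freqNormSq_rpow_neg (d := d) (by rw [hd]; norm_num)).mul_left C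
  refine continuousOn_tsum (fun k => ?_) hMs (fun k τ hτ => ?_)
  · exact continuousOn_const.mul (continuousOn_mFourierCoeff hab hw k).norm
  · rw [norm_mul, norm_norm, Real.norm_eq_abs]
    by_cases hk : k = 0
    · have h0 : mFourierCoeff (EuclideanSpace.complexify ∘ w τ) 0 = 0 :=
        mFourierCoeff_complexify_zero_of_hasZeroMean (hw.isSmooth_slice hτ).integrable
          (hmean τ hτ)
      simp only [hM, hk, h0, norm_zero, mul_zero, if_true, le_refl]
    · have hx : 1 ≤ freqNormSq k := one_le_freqNormSq_of_ne_zero hk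
      simp only [hM, if_neg hk]
      calc |φ k| * ‖mFourierCoeff (EuclideanSpace.complexify ∘ w τ) k‖
          ≤ freqNormSq k * ‖mFourierCoeff (EuclideanSpace.complexify ∘ w τ) k‖ :=
            mul_le_mul_of_nonneg_right (hφ k hk) (norm_nonneg _)
        _ ≤ C * freqNormSq k ^ (-(2 : ℝ)) :=
            mul_le_of_cube_mul_le hx (hC τ hτ k)

end Window


section Window2

variable {a b : ℝ} {u : ℝ → UnitAddTorus d → EuclideanSpace ℝ d}

omit [DecidableEq d] in
/-- **The time derivative of a field with mean-zero slices has zero mean**: the zero mode of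
`∂ₜu` vanishes (uniqueness of the derivative within `[a, b]` of the constant zero mode).
[folklore] -/
private theorem mFourierCoeff_timeDerivWithin_zero (hab : a < b)
    (hu : Torus.IsSmoothSpaceTimeOn (Icc a b) u) (hmean : ∀ τ ∈ Icc a b, Torus.HasZeroMean (u τ))
    {τ : ℝ} (hτ : τ ∈ Icc a b) :
    mFourierCoeff (EuclideanSpace.complexify ∘ timeDerivWithin (Icc a b) u τ) 0 = 0 := by
  have hU : UniqueDiffOn ℝ (Icc a b) := uniqueDiffOn_Icc hab
  have h1 := hasDerivWithinAt_mFourierCoeff_complexify hu (convex_Icc a b) hU hτ (0 : d → ℤ)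
  have h0 : ∀ s ∈ Icc a b, mFourierCoeff (EuclideanSpace.complexify ∘ u s) (0 : d → ℤ) = 0 :=
    fun s hs => mFourierCoeff_complexify_zero_of_hasZeroMean (hu.isSmooth_slice hs).integrable
      (hmean s hs)
  have h2 : HasDerivWithinAt (fun s => mFourierCoeff (EuclideanSpace.complexify ∘ u s) (0 : d → ℤ))
      (0 : EuclideanSpace ℂ d) (Icc a b) τ :=
    (hasDerivWithinAt_const τ (Icc a b) (0 : EuclideanSpace ℂ d)).congr_of_mem
      (fun s hs => h0 s hs) hτ
  exact UniqueDiffWithinAt.eq_deriv _ (hU τ hτ) h1 h2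

end Window2

/-! ### §3 The regularised Wiener norm and its derivative along a classical solution -/

section Regularised

omit [Fintype d] [DecidableEq d] in
/-- `0 < √(n² + c²)` for `c > 0`. [folklore] -/
private theorem sqrt_sq_add_sq_pos (n : ℝ) {c : ℝ} (hc : 0 < c) : 0 < Real.sqrt (n ^ 2 + c ^ 2) :=
  Real.sqrt_pos.2 (by positivity)

omit [Fintype d] [DecidableEq d] in
/-- `n ≤ √(n² + c²)`. [folklore] -/
private theorem le_sqrt_sq_add_sq (n c : ℝ) : n ≤ Real.sqrt (n ^ 2 + c ^ 2) := by
  rcases le_or_gt 0 n with hn | hn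
  · exact (Real.le_sqrt hn (by positivity)).2 (by nlinarith [sq_nonneg c])
  · exact hn.le.trans (Real.sqrt_nonneg _)

omit [Fintype d] [DecidableEq d] in
/-- `√(n² + c²) ≤ n + c` for `n, c ≥ 0`. [folklore] -/
private theorem sqrt_sq_add_sq_le_add {n c : ℝ} (hn : 0 ≤ n) (hc : 0 ≤ c) :
    Real.sqrt (n ^ 2 + c ^ 2) ≤ n + c := by
  rw [Real.sqrt_le_left (by positivity)]
  nlinarith [mul_nonneg hn hc]

omit [Fintype d] [DecidableEq d] in
/-- `n − c ≤ n² / √(n² + c²)` for `n ≥ 0`, `c > 0` (the regularisation costs at most `c`).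
[folklore] -/
private theorem sub_le_sq_div_sqrt {n c : ℝ} (hn : 0 ≤ n) (hc : 0 < c) :
    n - c ≤ n ^ 2 / Real.sqrt (n ^ 2 + c ^ 2) := by
  have hg := sqrt_sq_add_sq_pos n hc
  rw [le_div_iff₀ hg]
  have h1 : n * Real.sqrt (n ^ 2 + c ^ 2) ≤ n * (n + c) :=
    mul_le_mul_of_nonneg_left (sqrt_sq_add_sq_le_add hn hc.le) hn
  have h2 : c * n ≤ c * Real.sqrt (n ^ 2 + c ^ 2) :=
    mul_le_mul_of_nonneg_left (le_sqrt_sq_add_sq n c) hc.le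
  nlinarith

omit [DecidableEq d] in
/-- `|2 Re⟪α, β⟫ / (2 √(‖β‖² + c²))| ≤ ‖α‖` for `c > 0`. [folklore] -/
private theorem abs_two_mul_re_inner_div_le (α β : EuclideanSpace ℂ d) {c : ℝ} (hc : 0 < c) :
    |2 * (inner ℂ α β).re / (2 * Real.sqrt (‖β‖ ^ 2 + c ^ 2))| ≤ ‖α‖ := by
  have hg := sqrt_sq_add_sq_pos ‖β‖ hc
  rw [mul_div_mul_left _ _ (two_ne_zero), abs_div, abs_of_pos hg, div_le_iff₀ hg]
  calc |(inner ℂ α β).re| ≤ ‖inner ℂ α β‖ := Complex.abs_re_le_norm _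
    _ ≤ ‖α‖ * ‖β‖ := norm_inner_le_norm α β
    _ ≤ ‖α‖ * Real.sqrt (‖β‖ ^ 2 + c ^ 2) :=
        mul_le_mul_of_nonneg_left (le_sqrt_sq_add_sq ‖β‖ c) (norm_nonneg _)


omit [Fintype d] [DecidableEq d] in
/-- The real arithmetic of the modewise bound: with `g = √(n² + δ²)` and `|r| ≤ N g`,
`(2(−4π²νx n² − r))/(2g) ≤ −4π²ν x n + 4π²ν x δ + N` (`x, n ≥ 0`, `ν ≥ 0`, `δ > 0`). [folklore] -/
private theorem modewise_le' {ν x n δ r N : ℝ} (hν : 0 ≤ ν) (hx : 0 ≤ x) (hn : 0 ≤ n) (hδ : 0 < δ)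
    (hr : |r| ≤ N * Real.sqrt (n ^ 2 + δ ^ 2)) :
    2 * (-(ν * (4 * Real.pi ^ 2 * x)) * n ^ 2 - r) / (2 * Real.sqrt (n ^ 2 + δ ^ 2)) ≤
      -(4 * Real.pi ^ 2 * ν) * (x * n) + 4 * Real.pi ^ 2 * ν * (x * δ) + N := by
  have hg := sqrt_sq_add_sq_pos n hδ
  set g := Real.sqrt (n ^ 2 + δ ^ 2) with hgdef
  have e : 2 * (-(ν * (4 * Real.pi ^ 2 * x)) * n ^ 2 - r) / (2 * g) =
      -(4 * Real.pi ^ 2 * ν) * (x * (n ^ 2 / g)) + (-r / g) := by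
    field_simp
    ring
  rw [e]
  have h1 : x * (n - δ) ≤ x * (n ^ 2 / g) := mul_le_mul_of_nonneg_left (sub_le_sq_div_sqrt hn hδ) hx
  have h1' : -(4 * Real.pi ^ 2 * ν) * (x * (n ^ 2 / g)) ≤ -(4 * Real.pi ^ 2 * ν) * (x * (n - δ)) :=
    mul_le_mul_of_nonpos_left h1 (by have := Real.pi_pos; nlinarith [sq_nonneg Real.pi])
  have h2 : -r / g ≤ N := by
    rw [div_le_iff₀ hg]
    have := neg_abs_le r
    nlinarith [abs_nonneg r]
  nlinarith [h1', h2]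

omit [DecidableEq d] in
/-- The zero force has zero Fourier coefficients. [folklore] -/
private theorem mFourierCoeff_complexify_zero_force (t : ℝ) (k : d → ℤ) :
    mFourierCoeff (EuclideanSpace.complexify ∘
      (0 : ℝ → UnitAddTorus d → EuclideanSpace ℝ d) t) k = 0 := by
  have h : (EuclideanSpace.complexify ∘ (0 : ℝ → UnitAddTorus d → EuclideanSpace ℝ d) t) =
      (0 : UnitAddTorus d → EuclideanSpace ℂ d) := by
    funext x
    simp
  rw [h, mFourierCoeff_eq_integral_volume]
  simp


variable {ν a b : ℝ} {u : ℝ → UnitAddTorus d → EuclideanSpace ℝ d} {p : ℝ → UnitAddTorus d → ℝ}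

omit [DecidableEq d] in
/-- **The regularised Wiener norm is differentiable in time, termwise** ("dividing by
`(|û(k)|² + ε)^{1/2}` and letting `ε` tend to zero", Robinson–Sadowski–Silva, proof of Lemma 5.1):
for `u` jointly smooth on `[a, b] × T³` with mean-zero slices and `ε > 0`, the sum
`G_ε(τ) = ∑_k √(‖û(τ,k)‖² + ε²θ(k)²)`, `θ(k) = (1 + |k|²)⁻³`, is differentiable at interior times
with derivative `∑_k 2Re⟪𝓕(∂ₜu)(k), û(k)⟫/(2√(‖û(k)‖² + ε²θ(k)²))`
(`hasDerivAt_tsum_of_isPreconnected`, majorant `‖𝓕(∂ₜu)(k)‖ ≤ C|k|⁻⁶`, the zero mode of `∂ₜu`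
vanishing). [cite: RobinsonSadowskiSilva2012, §V.B Lemma 5.1 (proof, (5.2))] -/
theorem hasDerivAt_tsum_regularisedWiener (hd : Fintype.card d = 3) (hab : a < b)
    (hu : Torus.IsSmoothSpaceTimeOn (Icc a b) u) (hmean : ∀ τ ∈ Icc a b, Torus.HasZeroMean (u τ))
    {ε : ℝ} (hε : 0 < ε) {t : ℝ} (ht : t ∈ Ioo a b) :
    HasDerivAt (fun τ => ∑' k : d → ℤ,
        Real.sqrt (‖mFourierCoeff (EuclideanSpace.complexify ∘ u τ) k‖ ^ 2 +
          (ε * ((1 + freqNormSq k) ^ 3)⁻¹) ^ 2))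
      (∑' k : d → ℤ,
        (2 * (inner ℂ (mFourierCoeff (EuclideanSpace.complexify ∘ timeDerivWithin (Icc a b) u t) k)
            (mFourierCoeff (EuclideanSpace.complexify ∘ u t) k)).re /
          (2 * Real.sqrt (‖mFourierCoeff (EuclideanSpace.complexify ∘ u t) k‖ ^ 2 +
            (ε * ((1 + freqNormSq k) ^ 3)⁻¹) ^ 2)))) t := by
  classical
  have hU : UniqueDiffOn ℝ (Icc a b) := uniqueDiffOn_Icc hab
  have hw : Torus.IsSmoothSpaceTimeOn (Icc a b) (timeDerivWithin (Icc a b) u) :=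
    hu.timeDerivWithin hU
  obtain ⟨C, hC0, hC⟩ := exists_forall_freqNormSq_cube_mul_norm_le hab hw
  have hθ : ∀ k : d → ℤ, 0 < ε * ((1 + freqNormSq k) ^ 3)⁻¹ := fun k =>
    mul_pos hε (inv_pos.2 (pow_pos (by linarith [freqNormSq_nonneg k]) 3))
  set M : (d → ℤ) → ℝ := fun k =>
    C * (if k = 0 then (0 : ℝ) else freqNormSq k ^ (-(3 : ℝ))) with hM
  have hMs : Summable M :=
    (summable_ite_freqNormSq_rpow_neg (d := d) (by rw [hd]; norm_num)).mul_left C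
  have hderiv : ∀ (k : d → ℤ) (τ : ℝ), τ ∈ Ioo a b →
      HasDerivAt (fun τ => Real.sqrt (‖mFourierCoeff (EuclideanSpace.complexify ∘ u τ) k‖ ^ 2 +
          (ε * ((1 + freqNormSq k) ^ 3)⁻¹) ^ 2))
        (2 * (inner ℂ (mFourierCoeff (EuclideanSpace.complexify ∘
            timeDerivWithin (Icc a b) u τ) k)
            (mFourierCoeff (EuclideanSpace.complexify ∘ u τ) k)).re /
          (2 * Real.sqrt (‖mFourierCoeff (EuclideanSpace.complexify ∘ u τ) k‖ ^ 2 +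
            (ε * ((1 + freqNormSq k) ^ 3)⁻¹) ^ 2))) τ := by
    intro k τ hτ
    have h1 := (hasDerivWithinAt_norm_sq_mFourierCoeff hu (convex_Icc a b) hU
      (Ioo_subset_Icc_self hτ) k).hasDerivAt (Icc_mem_nhds hτ.1 hτ.2)
    exact (h1.add_const ((ε * ((1 + freqNormSq k) ^ 3)⁻¹) ^ 2)).sqrt
      (add_pos_of_nonneg_of_pos (sq_nonneg _) (pow_pos (hθ k) 2)).ne'
  have hbound : ∀ (k : d → ℤ) (τ : ℝ), τ ∈ Ioo a b →
      ‖2 * (inner ℂ (mFourierCoeff (EuclideanSpace.complexify ∘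
            timeDerivWithin (Icc a b) u τ) k)
            (mFourierCoeff (EuclideanSpace.complexify ∘ u τ) k)).re /
          (2 * Real.sqrt (‖mFourierCoeff (EuclideanSpace.complexify ∘ u τ) k‖ ^ 2 +
            (ε * ((1 + freqNormSq k) ^ 3)⁻¹) ^ 2))‖ ≤ M k := by
    intro k τ hτ
    have hτ' : τ ∈ Icc a b := Ioo_subset_Icc_self hτ
    set α : EuclideanSpace ℂ d :=
      mFourierCoeff (EuclideanSpace.complexify ∘ timeDerivWithin (Icc a b) u τ) k with hα
    set β : EuclideanSpace ℂ d := mFourierCoeff (EuclideanSpace.complexify ∘ u τ) k with hβ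
    rw [Real.norm_eq_abs]
    have hq := abs_two_mul_re_inner_div_le α β (hθ k)
    by_cases hk : k = 0
    · have hM0 : M k = 0 := by simp only [hM, if_pos hk, mul_zero]
      have hα0 : α = 0 := by
        rw [hα, hk]; exact mFourierCoeff_timeDerivWithin_zero hab hu hmean hτ'
      rw [hM0]
      refine le_of_eq ?_
      rw [hα0, inner_zero_left, Complex.zero_re, mul_zero, zero_div, abs_zero]
    · have hx : 1 ≤ freqNormSq k := one_le_freqNormSq_of_ne_zero hk
      simp only [hM, if_neg hk]
      exact hq.trans (le_of_cube_mul_le hx (hC τ hτ' k))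
  have hsum0 : Summable fun k : d → ℤ =>
      Real.sqrt (‖mFourierCoeff (EuclideanSpace.complexify ∘ u t) k‖ ^ 2 +
        (ε * ((1 + freqNormSq k) ^ 3)⁻¹) ^ 2) := by
    have hut : IsSmooth (u t) := hu.isSmooth_slice (Ioo_subset_Icc_self ht)
    refine ((summable_norm hut).add ((summable_theta hd).mul_left ε)).of_nonneg_of_le
      (fun k => Real.sqrt_nonneg _) fun k => sqrt_sq_add_sq_le_add (norm_nonneg _) (hθ k).le
  exact hasDerivAt_tsum_of_isPreconnected hMs isOpen_Ioo isPreconnected_Ioo hderiv hbound ht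
    hsum0 ht

/-- **The modewise inequality (5.2), summed, for the regularised Wiener norm** (Robinson–Sadowski–
Silva, proof of Lemma 5.1: "`d/dt|û(k)| + |k|²|û(k)| ≤ |((u·∇)u)ˆ(k)|` … summing over `k` gives
`d/dt‖u‖_{F_0} + ‖u‖_{F_2} ≤ ∑_k|((u·∇)u)ˆ(k)| ≤ ∑_{k,l}|û(k−l)||l||û(l)| ≤ ‖u‖_{F_0}‖u‖_{F_1}`";
viscosity and `2π` restored): along a classical solution of the unforced Navier–Stokes equations
(`ν ≥ 0`) on `[a, b] × T³` with mean-zero slices, for `ε > 0` and `τ ∈ [a, b]`,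
`G_ε' ≤ −4π²ν F_2 + 4π²ν ε ∑_k|k|²θ(k) + 2π F_0 F_1`
(`F_r = ∑_k |k|^r ‖û(k)‖`). [cite: RobinsonSadowskiSilva2012, §V.B Lemma 5.1 (proof)] -/
theorem tsum_regularisedWienerDeriv_le (hd : Fintype.card d = 3) (hν : 0 ≤ ν) (hab : a < b)
    (h : Torus.IsClassicalNSSolutionOn (Icc a b) ν 0 u p) {ε : ℝ} (hε : 0 < ε) {τ : ℝ}
    (hτ : τ ∈ Icc a b) :
    (∑' k : d → ℤ,
        (2 * (inner ℂ (mFourierCoeff (EuclideanSpace.complexify ∘ timeDerivWithin (Icc a b) u τ) k)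
            (mFourierCoeff (EuclideanSpace.complexify ∘ u τ) k)).re /
          (2 * Real.sqrt (‖mFourierCoeff (EuclideanSpace.complexify ∘ u τ) k‖ ^ 2 +
            (ε * ((1 + freqNormSq k) ^ 3)⁻¹) ^ 2)))) ≤
      -(4 * Real.pi ^ 2 * ν) * (∑' k : d → ℤ, freqNormSq k *
          ‖mFourierCoeff (EuclideanSpace.complexify ∘ u τ) k‖) +
        4 * Real.pi ^ 2 * ν * ε *
          (∑' k : d → ℤ, freqNormSq k * ((1 + freqNormSq k) ^ 3)⁻¹) +
        2 * Real.pi * ((∑' k : d → ℤ, ‖mFourierCoeff (EuclideanSpace.complexify ∘ u τ) k‖) *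
          (∑' k : d → ℤ, Real.sqrt (freqNormSq k) *
            ‖mFourierCoeff (EuclideanSpace.complexify ∘ u τ) k‖)) := by
  classical
  have hU : UniqueDiffOn ℝ (Icc a b) := uniqueDiffOn_Icc hab
  have hut : IsSmooth (u τ) := h.smooth_velocity.isSmooth_slice hτ
  have hdt : IsSmooth (timeDerivWithin (Icc a b) u τ) :=
    h.smooth_velocity.isSmooth_timeDerivWithin hU hτ
  set c : (d → ℤ) → EuclideanSpace ℂ d := fun k => mFourierCoeff (EuclideanSpace.complexify ∘ u τ) k
    with hc
  set wv : (d → ℤ) → EuclideanSpace ℂ d :=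
    fun k => mFourierCoeff (EuclideanSpace.complexify ∘ timeDerivWithin (Icc a b) u τ) k with hwv
  set B : (d → ℤ) → EuclideanSpace ℂ d :=
    fun k => mFourierCoeff (EuclideanSpace.complexify ∘ Torus.convect (u τ) (u τ)) k with hB
  set θ : (d → ℤ) → ℝ := fun k => ((1 + freqNormSq k) ^ 3)⁻¹ with hθ
  set cv : (d → ℤ) → ℝ :=
    fun k => ∑' m : d → ℤ, ‖c m‖ * (Real.sqrt (freqNormSq (k - m)) * ‖c (k - m)‖) with hcv
  have hθpos : ∀ k, 0 < ε * θ k := fun k =>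
    mul_pos hε (inv_pos.2 (pow_pos (by linarith [freqNormSq_nonneg k]) 3))
  -- the Wiener algebra with `b = |·| ‖c‖`
  obtain ⟨hfib, hscv, hcv_eq⟩ := tsum_tsum_mul_mul_sub (a := fun k => ‖c k‖)
    (b := fun k => Real.sqrt (freqNormSq k) * ‖c k‖) (fun k => norm_nonneg _)
    (fun k => mul_nonneg (Real.sqrt_nonneg _) (norm_nonneg _)) (summable_norm hut)
    (summable_sqrt_mul_norm hut)
  have hcv0 : ∀ k, 0 ≤ cv k := fun k => tsum_nonneg fun m =>
    mul_nonneg (norm_nonneg _) (mul_nonneg (Real.sqrt_nonneg _) (norm_nonneg _))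
  have hid : ∀ k, (inner ℂ (wv k) (c k)).re =
      -(ν * (4 * Real.pi ^ 2 * freqNormSq k)) * ‖c k‖ ^ 2 - (inner ℂ (B k) (c k)).re := by
    intro k
    have h1 := h.re_inner_mFourierCoeff_timeDerivWithin hU hτ k
    rw [mFourierCoeff_complexify_zero_force, inner_zero_left, Complex.zero_re, add_zero] at h1
    exact h1
  have hBle : ∀ k, ‖B k‖ ≤ 2 * Real.pi * cv k := fun k =>
    norm_mFourierCoeff_convect_le_adv hut hut k
  have hterm : ∀ k, 2 * (inner ℂ (wv k) (c k)).re / (2 * Real.sqrt (‖c k‖ ^ 2 + (ε * θ k) ^ 2)) ≤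
      -(4 * Real.pi ^ 2 * ν) * (freqNormSq k * ‖c k‖) +
        4 * Real.pi ^ 2 * ν * (freqNormSq k * (ε * θ k)) + 2 * Real.pi * cv k := by
    intro k
    rw [hid k]
    refine modewise_le' hν (freqNormSq_nonneg k) (norm_nonneg _) (hθpos k) ?_
    calc |(inner ℂ (B k) (c k)).re| ≤ ‖inner ℂ (B k) (c k)‖ := Complex.abs_re_le_norm _
      _ ≤ ‖B k‖ * ‖c k‖ := norm_inner_le_norm _ _
      _ ≤ 2 * Real.pi * cv k * Real.sqrt (‖c k‖ ^ 2 + (ε * θ k) ^ 2) :=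
          mul_le_mul (hBle k) (le_sqrt_sq_add_sq _ _) (norm_nonneg _)
            (mul_nonneg (by positivity) (hcv0 k))
  have hsl : Summable fun k : d → ℤ =>
      2 * (inner ℂ (wv k) (c k)).re / (2 * Real.sqrt (‖c k‖ ^ 2 + (ε * θ k) ^ 2)) := by
    refine Summable.of_norm_bounded (summable_norm hdt) fun k => ?_
    rw [Real.norm_eq_abs]
    exact abs_two_mul_re_inner_div_le (wv k) (c k) (hθpos k)
  have hsX : Summable fun k : d → ℤ => freqNormSq k * ‖c k‖ := summable_freqNormSq_mul_norm hut
  have hsΘ : Summable fun k : d → ℤ => freqNormSq k * (ε * θ k) := by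
    have := (summable_freqNormSq_mul_theta hd).mul_left ε
    refine this.congr fun k => ?_
    simp only [hθ]; ring
  have hsr : Summable fun k : d → ℤ => -(4 * Real.pi ^ 2 * ν) * (freqNormSq k * ‖c k‖) +
      4 * Real.pi ^ 2 * ν * (freqNormSq k * (ε * θ k)) + 2 * Real.pi * cv k :=
    ((hsX.mul_left _).add (hsΘ.mul_left _)).add (hscv.mul_left _)
  have hΘ : ∑' k : d → ℤ, freqNormSq k * (ε * θ k) = ε * ∑' k : d → ℤ, freqNormSq k * θ k := by
    rw [← tsum_mul_left]
    exact tsum_congr fun k => by ring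
  calc _ ≤ ∑' k : d → ℤ, (-(4 * Real.pi ^ 2 * ν) * (freqNormSq k * ‖c k‖) +
        4 * Real.pi ^ 2 * ν * (freqNormSq k * (ε * θ k)) + 2 * Real.pi * cv k) :=
        hsl.tsum_le_tsum hterm hsr
    _ = -(4 * Real.pi ^ 2 * ν) * (∑' k : d → ℤ, freqNormSq k * ‖c k‖) +
        4 * Real.pi ^ 2 * ν * (∑' k : d → ℤ, freqNormSq k * (ε * θ k)) +
        2 * Real.pi * ∑' k : d → ℤ, cv k := by
        rw [((hsX.mul_left _).add (hsΘ.mul_left _)).tsum_add (hscv.mul_left _),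
          (hsX.mul_left _).tsum_add (hsΘ.mul_left _), tsum_mul_left, tsum_mul_left, tsum_mul_left]
    _ = _ := by rw [hΘ, hcv_eq]; ring

omit [DecidableEq d] in
/-- Continuity in time of the termwise derivative of the regularised Wiener norm. [folklore] -/
private theorem continuousOn_tsum_regularisedWienerDeriv (hd : Fintype.card d = 3) (hab : a < b)
    (hu : Torus.IsSmoothSpaceTimeOn (Icc a b) u) (hmean : ∀ τ ∈ Icc a b, Torus.HasZeroMean (u τ))
    {ε : ℝ} (hε : 0 < ε) :
    ContinuousOn (fun τ => ∑' k : d → ℤ,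
        (2 * (inner ℂ (mFourierCoeff (EuclideanSpace.complexify ∘ timeDerivWithin (Icc a b) u τ) k)
            (mFourierCoeff (EuclideanSpace.complexify ∘ u τ) k)).re /
          (2 * Real.sqrt (‖mFourierCoeff (EuclideanSpace.complexify ∘ u τ) k‖ ^ 2 +
            (ε * ((1 + freqNormSq k) ^ 3)⁻¹) ^ 2)))) (Icc a b) := by
  classical
  have hU : UniqueDiffOn ℝ (Icc a b) := uniqueDiffOn_Icc hab
  have hw : Torus.IsSmoothSpaceTimeOn (Icc a b) (timeDerivWithin (Icc a b) u) :=
    hu.timeDerivWithin hU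
  obtain ⟨C, hC0, hC⟩ := exists_forall_freqNormSq_cube_mul_norm_le hab hw
  have hθ : ∀ k : d → ℤ, 0 < ε * ((1 + freqNormSq k) ^ 3)⁻¹ := fun k =>
    mul_pos hε (inv_pos.2 (pow_pos (by linarith [freqNormSq_nonneg k]) 3))
  set M : (d → ℤ) → ℝ := fun k =>
    C * (if k = 0 then (0 : ℝ) else freqNormSq k ^ (-(3 : ℝ))) with hM
  have hMs : Summable M :=
    (summable_ite_freqNormSq_rpow_neg (d := d) (by rw [hd]; norm_num)).mul_left C
  refine continuousOn_tsum (fun k => ?_) hMs (fun k τ hτ => ?_)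
  · have hwv := continuousOn_mFourierCoeff hab hw k
    have hc := continuousOn_mFourierCoeff hab hu k
    have hin : ContinuousOn (fun τ => (inner ℂ
        (mFourierCoeff (EuclideanSpace.complexify ∘ timeDerivWithin (Icc a b) u τ) k)
        (mFourierCoeff (EuclideanSpace.complexify ∘ u τ) k)).re) (Icc a b) :=
      Complex.continuous_re.comp_continuousOn (hwv.inner hc)
    have hden : ContinuousOn (fun τ => 2 * Real.sqrt
        (‖mFourierCoeff (EuclideanSpace.complexify ∘ u τ) k‖ ^ 2 +
          (ε * ((1 + freqNormSq k) ^ 3)⁻¹) ^ 2)) (Icc a b) :=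
      continuousOn_const.mul ((hc.norm.pow 2).add continuousOn_const).sqrt
    refine (continuousOn_const.mul hin).div hden fun τ _ => ?_
    exact mul_ne_zero two_ne_zero (sqrt_sq_add_sq_pos _ (hθ k)).ne'
  · set α : EuclideanSpace ℂ d :=
      mFourierCoeff (EuclideanSpace.complexify ∘ timeDerivWithin (Icc a b) u τ) k with hα
    set β : EuclideanSpace ℂ d := mFourierCoeff (EuclideanSpace.complexify ∘ u τ) k with hβ
    rw [Real.norm_eq_abs]
    have hq := abs_two_mul_re_inner_div_le α β (hθ k)
    by_cases hk : k = 0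
    · have hM0 : M k = 0 := by simp only [hM, if_pos hk, mul_zero]
      have hα0 : α = 0 := by
        rw [hα, hk]; exact mFourierCoeff_timeDerivWithin_zero hab hu hmean hτ
      rw [hM0]
      refine le_of_eq ?_
      rw [hα0, inner_zero_left, Complex.zero_re, mul_zero, zero_div, abs_zero]
    · have hx : 1 ≤ freqNormSq k := one_le_freqNormSq_of_ne_zero hk
      simp only [hM, if_neg hk]
      exact hq.trans (le_of_cube_mul_le hx (hC τ hτ k))

omit [DecidableEq d] in
/-- Continuity in time of the regularised Wiener norm `G_ε`. [folklore] -/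
private theorem continuousOn_tsum_regularisedWiener (hd : Fintype.card d = 3) (hab : a < b)
    (hu : Torus.IsSmoothSpaceTimeOn (Icc a b) u) (hmean : ∀ τ ∈ Icc a b, Torus.HasZeroMean (u τ))
    {ε : ℝ} (hε : 0 < ε) :
    ContinuousOn (fun τ => ∑' k : d → ℤ,
        Real.sqrt (‖mFourierCoeff (EuclideanSpace.complexify ∘ u τ) k‖ ^ 2 +
          (ε * ((1 + freqNormSq k) ^ 3)⁻¹) ^ 2)) (Icc a b) := by
  classical
  obtain ⟨C, hC0, hC⟩ := exists_forall_freqNormSq_cube_mul_norm_le hab hu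
  have hθ : ∀ k : d → ℤ, 0 < ε * ((1 + freqNormSq k) ^ 3)⁻¹ := fun k =>
    mul_pos hε (inv_pos.2 (pow_pos (by linarith [freqNormSq_nonneg k]) 3))
  set M : (d → ℤ) → ℝ := fun k =>
    C * (if k = 0 then (0 : ℝ) else freqNormSq k ^ (-(3 : ℝ))) +
      ε * ((1 + freqNormSq k) ^ 3)⁻¹ with hM
  have hMs : Summable M :=
    ((summable_ite_freqNormSq_rpow_neg (d := d) (by rw [hd]; norm_num)).mul_left C).add
      ((summable_theta hd).mul_left ε)
  refine continuousOn_tsum (fun k => ?_) hMs (fun k τ hτ => ?_)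
  · have hc := continuousOn_mFourierCoeff hab hu k
    exact ((hc.norm.pow 2).add continuousOn_const).sqrt
  · set β : EuclideanSpace ℂ d := mFourierCoeff (EuclideanSpace.complexify ∘ u τ) k with hβ
    rw [Real.norm_eq_abs, abs_of_nonneg (Real.sqrt_nonneg _)]
    have hg : Real.sqrt (‖β‖ ^ 2 + (ε * ((1 + freqNormSq k) ^ 3)⁻¹) ^ 2) ≤
        ‖β‖ + ε * ((1 + freqNormSq k) ^ 3)⁻¹ := sqrt_sq_add_sq_le_add (norm_nonneg _) (hθ k).le
    have hfirst : ‖β‖ ≤ C * (if k = 0 then (0 : ℝ) else freqNormSq k ^ (-(3 : ℝ))) := by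
      by_cases hk : k = 0
      · have h0 : β = 0 := by
          rw [hβ, hk]
          exact mFourierCoeff_complexify_zero_of_hasZeroMean (hu.isSmooth_slice hτ).integrable
            (hmean τ hτ)
        rw [h0, norm_zero, if_pos hk, mul_zero]
      · have hx : 1 ≤ freqNormSq k := one_le_freqNormSq_of_ne_zero hk
        rw [if_neg hk]
        exact le_of_cube_mul_le hx (hC τ hτ k)
    exact hg.trans (add_le_add hfirst le_rfl)

end Regularised

/-! ### §4 The balance integrated in time: `F_0(t₂) + 4π²ν∫F_2 ≤ F_0(t₁) + 2π∫F_0F_1` -/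

section Integrated

variable {ν a b : ℝ} {u : ℝ → UnitAddTorus d → EuclideanSpace ℝ d} {p : ℝ → UnitAddTorus d → ℝ}

omit [Fintype d] [DecidableEq d] in
/-- `√x ≤ x` for `x ≥ 1`. [folklore] -/
private theorem sqrt_le_self_of_one_le {x : ℝ} (hx : 1 ≤ x) : Real.sqrt x ≤ x :=
  (Real.sqrt_le_left (by linarith)).2 (by nlinarith)

omit [Fintype d] [DecidableEq d] in
/-- **Young's inequality step** ("An application of Young's inequality yields
`d/dt‖u‖_{F_0} ≤ ‖u‖³_{F_0}`", Robinson–Sadowski–Silva, end of the proof of Lemma 5.1; constants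
kept): if `F₁² ≤ F₀F₂` then `2π F₀F₁ ≤ 2π²ν F₂ + (2ν)⁻¹ F₀³` (`F₀, F₁, F₂ ≥ 0`, `ν > 0`).
[folklore] -/
private theorem two_pi_mul_mul_le {ν F0 F1 F2 : ℝ} (hν : 0 < ν) (h0 : 0 ≤ F0) (h1 : 0 ≤ F1)
    (h2 : 0 ≤ F2) (hcs : F1 ^ 2 ≤ F0 * F2) :
    2 * Real.pi * (F0 * F1) ≤ 2 * Real.pi ^ 2 * ν * F2 + (2 * ν)⁻¹ * F0 ^ 3 := by
  have hπ := Real.pi_pos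
  have hX : 0 ≤ 2 * Real.pi ^ 2 * ν * F2 := by positivity
  have hY : 0 ≤ (2 * ν)⁻¹ * F0 ^ 3 := by positivity
  have hXY : (2 * Real.pi ^ 2 * ν * F2) * ((2 * ν)⁻¹ * F0 ^ 3) = Real.pi ^ 2 * (F0 ^ 3 * F2) := by
    field_simp
  have hsq : (2 * Real.pi * (F0 * F1)) ^ 2 ≤
      (2 * Real.pi ^ 2 * ν * F2 + (2 * ν)⁻¹ * F0 ^ 3) ^ 2 := by
    calc (2 * Real.pi * (F0 * F1)) ^ 2 = 4 * Real.pi ^ 2 * F0 ^ 2 * F1 ^ 2 := by ring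
      _ ≤ 4 * Real.pi ^ 2 * F0 ^ 2 * (F0 * F2) := mul_le_mul_of_nonneg_left hcs (by positivity)
      _ = 4 * ((2 * Real.pi ^ 2 * ν * F2) * ((2 * ν)⁻¹ * F0 ^ 3)) := by rw [hXY]; ring
      _ ≤ _ := by nlinarith [sq_nonneg (2 * Real.pi ^ 2 * ν * F2 - (2 * ν)⁻¹ * F0 ^ 3)]
  have h01 : 0 ≤ 2 * Real.pi * (F0 * F1) := by positivity
  exact (le_abs_self _).trans (abs_le_of_sq_le_sq hsq (add_nonneg hX hY))

/-- **Robinson–Sadowski–Silva 2012, proof of Lemma 5.1, integrated form on `T³`** ("Summing over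
`k` gives `d/dt‖u‖_{F_0} + ‖u‖_{F_2} ≤ ∑_k|((u·∇)u)ˆ(k)| ≤ ∑_{k,l}|û(k−l)||l||û(l)| ≤
‖u‖_{F_0}‖u‖_{F_1}`", `‖u‖_{F_r} = ∑_k|k|^r|û(k)|`, §III (3.1)). In the tree's classical
vocabulary, viscosity and `2π` restored: for a classical solution of the unforced Navier–Stokes
equations with `ν ≥ 0` on `[a, b] × T^d`, `card d = 3`, with mean-zero slices, and
`a ≤ t₁ ≤ t₂ ≤ b`,
`F_0(t₂) + 4π²ν ∫_{t₁}^{t₂} F_2 ≤ F_0(t₁) + 2π ∫_{t₁}^{t₂} F_0 F_1`,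
`F_0(τ) = ∑_k‖û(τ,k)‖`, `F_1(τ) = ∑_k|k|‖û(τ,k)‖`, `F_2(τ) = ∑_k|k|²‖û(τ,k)‖`
(`|k| = (freqNormSq k)^{1/2}`). Proof: fundamental theorem of calculus for the regularised norm
`G_ε` (`hasDerivAt_tsum_regularisedWiener`, `tsum_regularisedWienerDeriv_le`), then `ε → 0`.
[cite: RobinsonSadowskiSilva2012, §V.B Lemma 5.1, proof ((5.2) summed), p. 115618-11] -/
theorem integral_balance (hd : Fintype.card d = 3) (hν : 0 ≤ ν) (hab : a < b)
    (h : Torus.IsClassicalNSSolutionOn (Icc a b) ν 0 u p)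
    (hmean : ∀ τ ∈ Icc a b, Torus.HasZeroMean (u τ)) {t₁ t₂ : ℝ} (h₁ : a ≤ t₁) (h₁₂ : t₁ ≤ t₂)
    (h₂ : t₂ ≤ b) :
    (∑' k : d → ℤ, ‖mFourierCoeff (EuclideanSpace.complexify ∘ u t₂) k‖) +
      4 * Real.pi ^ 2 * ν * ∫ τ in t₁..t₂, ∑' k : d → ℤ, freqNormSq k *
        ‖mFourierCoeff (EuclideanSpace.complexify ∘ u τ) k‖ ≤
    (∑' k : d → ℤ, ‖mFourierCoeff (EuclideanSpace.complexify ∘ u t₁) k‖) +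
      2 * Real.pi * ∫ τ in t₁..t₂,
        (∑' k : d → ℤ, ‖mFourierCoeff (EuclideanSpace.complexify ∘ u τ) k‖) *
        (∑' k : d → ℤ, Real.sqrt (freqNormSq k) *
          ‖mFourierCoeff (EuclideanSpace.complexify ∘ u τ) k‖) := by
  classical
  have hU : UniqueDiffOn ℝ (Icc a b) := uniqueDiffOn_Icc hab
  have hu := h.smooth_velocity
  have hsub : Icc t₁ t₂ ⊆ Icc a b := Icc_subset_Icc h₁ h₂
  have hsub' : Ioo t₁ t₂ ⊆ Ioo a b := Ioo_subset_Ioo h₁ h₂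
  -- notation
  set F0 : ℝ → ℝ := fun τ => ∑' k : d → ℤ, ‖mFourierCoeff (EuclideanSpace.complexify ∘ u τ) k‖
    with hF0
  set F1 : ℝ → ℝ := fun τ => ∑' k : d → ℤ, Real.sqrt (freqNormSq k) *
    ‖mFourierCoeff (EuclideanSpace.complexify ∘ u τ) k‖ with hF1
  set F2 : ℝ → ℝ := fun τ => ∑' k : d → ℤ, freqNormSq k *
    ‖mFourierCoeff (EuclideanSpace.complexify ∘ u τ) k‖ with hF2
  set θ : (d → ℤ) → ℝ := fun k => ((1 + freqNormSq k) ^ 3)⁻¹ with hθ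
  set Θ₀ : ℝ := ∑' k : d → ℤ, θ k with hΘ₀
  set Θ₂ : ℝ := ∑' k : d → ℤ, freqNormSq k * θ k with hΘ₂
  have hθ0 : ∀ k, 0 < θ k := fun k => inv_pos.2 (pow_pos (by linarith [freqNormSq_nonneg k]) 3)
  have hΘ₀0 : 0 ≤ Θ₀ := tsum_nonneg fun k => (hθ0 k).le
  have hΘ₂0 : 0 ≤ Θ₂ := tsum_nonneg fun k => mul_nonneg (freqNormSq_nonneg _) (hθ0 k).le
  -- continuity of `F_0, F_1, F_2` on the window
  have hF0c : ContinuousOn F0 (Icc a b) := by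
    have := continuousOn_tsum_weight_mul_norm hd hab hu hmean (φ := fun _ => (1 : ℝ))
      fun k hk => by rw [abs_one]; exact one_le_freqNormSq_of_ne_zero hk
    simpa only [one_mul] using this
  have hF1c : ContinuousOn F1 (Icc a b) :=
    continuousOn_tsum_weight_mul_norm hd hab hu hmean (φ := fun k => Real.sqrt (freqNormSq k))
      fun k hk => by
        rw [abs_of_nonneg (Real.sqrt_nonneg _)]
        exact sqrt_le_self_of_one_le (one_le_freqNormSq_of_ne_zero hk)
  have hF2c : ContinuousOn F2 (Icc a b) :=
    continuousOn_tsum_weight_mul_norm hd hab hu hmean (φ := fun k => freqNormSq k)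
      fun k _ => by rw [abs_of_nonneg (freqNormSq_nonneg _)]
  have hF2i : IntervalIntegrable F2 volume t₁ t₂ :=
    (hF2c.mono (by rw [uIcc_of_le h₁₂]; exact hsub)).intervalIntegrable
  have hF01i : IntervalIntegrable (fun τ => F0 τ * F1 τ) volume t₁ t₂ :=
    ((hF0c.mul hF1c).mono (by rw [uIcc_of_le h₁₂]; exact hsub)).intervalIntegrable
  -- it suffices to prove the inequality up to an arbitrary `δ > 0`
  refine le_of_forall_pos_le_add fun δ hδ => ?_
  set K : ℝ := Θ₀ + 4 * Real.pi ^ 2 * ν * Θ₂ * (t₂ - t₁) with hK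
  have hK0 : 0 ≤ K := by
    have : 0 ≤ t₂ - t₁ := by linarith
    positivity
  set ε : ℝ := δ / (K + 1) with hεdef
  have hε : 0 < ε := div_pos hδ (by linarith)
  have hεK : ε * K ≤ δ := by
    rw [hεdef, div_mul_eq_mul_div, div_le_iff₀ (by linarith)]
    nlinarith
  have hεθ : ∀ k, 0 < ε * θ k := fun k => mul_pos hε (hθ0 k)
  -- the regularised norm and its derivative
  set G : ℝ → ℝ := fun τ => ∑' k : d → ℤ,
    Real.sqrt (‖mFourierCoeff (EuclideanSpace.complexify ∘ u τ) k‖ ^ 2 + (ε * θ k) ^ 2) with hG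
  set D : ℝ → ℝ := fun τ => ∑' k : d → ℤ,
    (2 * (inner ℂ (mFourierCoeff (EuclideanSpace.complexify ∘ timeDerivWithin (Icc a b) u τ) k)
        (mFourierCoeff (EuclideanSpace.complexify ∘ u τ) k)).re /
      (2 * Real.sqrt (‖mFourierCoeff (EuclideanSpace.complexify ∘ u τ) k‖ ^ 2 + (ε * θ k) ^ 2)))
    with hD
  have hGc : ContinuousOn G (Icc t₁ t₂) :=
    (continuousOn_tsum_regularisedWiener hd hab hu hmean hε).mono hsub
  have hGd : ∀ τ ∈ Ioo t₁ t₂, HasDerivAt G (D τ) τ := fun τ hτ =>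
    hasDerivAt_tsum_regularisedWiener hd hab hu hmean hε (hsub' hτ)
  have hDc : ContinuousOn D (Icc a b) := continuousOn_tsum_regularisedWienerDeriv hd hab hu hmean hε
  have hDi : IntervalIntegrable D volume t₁ t₂ :=
    (hDc.mono (by rw [uIcc_of_le h₁₂]; exact hsub)).intervalIntegrable
  -- FTC and the bound on the derivative
  have hFTC : ∫ τ in t₁..t₂, D τ = G t₂ - G t₁ :=
    intervalIntegral.integral_eq_sub_of_hasDerivAt_of_le h₁₂ hGc hGd hDi
  set R : ℝ → ℝ := fun τ => -(4 * Real.pi ^ 2 * ν) * F2 τ + 4 * Real.pi ^ 2 * ν * ε * Θ₂ +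
    2 * Real.pi * (F0 τ * F1 τ) with hR
  have hRi : IntervalIntegrable R volume t₁ t₂ :=
    ((hF2i.const_mul _).add intervalIntegrable_const).add (hF01i.const_mul _)
  have hDR : ∫ τ in t₁..t₂, D τ ≤ ∫ τ in t₁..t₂, R τ :=
    intervalIntegral.integral_mono_on h₁₂ hDi hRi fun τ hτ =>
      tsum_regularisedWienerDeriv_le hd hν hab h hε (hsub hτ)
  have hRint : ∫ τ in t₁..t₂, R τ = -(4 * Real.pi ^ 2 * ν) * (∫ τ in t₁..t₂, F2 τ) +
      4 * Real.pi ^ 2 * ν * ε * Θ₂ * (t₂ - t₁) + 2 * Real.pi * ∫ τ in t₁..t₂, F0 τ * F1 τ := by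
    rw [hR, intervalIntegral.integral_add ((hF2i.const_mul _).add intervalIntegrable_const)
      (hF01i.const_mul _),
      intervalIntegral.integral_add (hF2i.const_mul _) intervalIntegrable_const]
    simp only [intervalIntegral.integral_const_mul, intervalIntegral.integral_const, smul_eq_mul]
    ring
  -- comparison of `G` with `F_0` at the two endpoints
  have hut₁ : IsSmooth (u t₁) := hu.isSmooth_slice (hsub (left_mem_Icc.2 h₁₂))
  have hut₂ : IsSmooth (u t₂) := hu.isSmooth_slice (hsub (right_mem_Icc.2 h₁₂))
  have hsumG : ∀ {t}, IsSmooth (u t) → Summable fun k : d → ℤ =>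
      Real.sqrt (‖mFourierCoeff (EuclideanSpace.complexify ∘ u t) k‖ ^ 2 + (ε * θ k) ^ 2) := by
    intro t hut
    exact ((summable_norm hut).add ((summable_theta hd).mul_left ε)).of_nonneg_of_le
      (fun k => Real.sqrt_nonneg _) fun k => sqrt_sq_add_sq_le_add (norm_nonneg _) (hεθ k).le
  have h2 : F0 t₂ ≤ G t₂ :=
    (summable_norm hut₂).tsum_le_tsum (fun k => le_sqrt_sq_add_sq _ _) (hsumG hut₂)
  have h1 : G t₁ ≤ F0 t₁ + ε * Θ₀ := by
    have hs1 := summable_norm hut₁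
    have hs2 := (summable_theta hd).mul_left ε
    calc G t₁ ≤ ∑' k : d → ℤ, (‖mFourierCoeff (EuclideanSpace.complexify ∘ u t₁) k‖ + ε * θ k) :=
          (hsumG hut₁).tsum_le_tsum (fun k => sqrt_sq_add_sq_le_add (norm_nonneg _) (hεθ k).le)
            (hs1.add hs2)
      _ = F0 t₁ + ε * Θ₀ := by rw [hs1.tsum_add hs2, tsum_mul_left]
  -- assemble
  have key : F0 t₂ + 4 * Real.pi ^ 2 * ν * (∫ τ in t₁..t₂, F2 τ) ≤
      F0 t₁ + 2 * Real.pi * (∫ τ in t₁..t₂, F0 τ * F1 τ) + ε * K := by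
    have := hFTC ▸ hDR
    rw [hRint] at this
    have hK' : ε * K = ε * Θ₀ + 4 * Real.pi ^ 2 * ν * ε * Θ₂ * (t₂ - t₁) := by rw [hK]; ring
    linarith
  linarith

/-- **Robinson–Sadowski–Silva 2012, proof of Lemma 5.1, the differential inequality
`d/dt‖u‖_{F_0} ≤ c‖u‖³_{F_0}` in integral form on `T³`** ("`… ≤ ‖u‖_{F_0}‖u‖_{F_1} ≤
‖u‖^{3/2}_{F_0}‖u‖^{1/2}_{F_2}`, using the `F_r` interpolation from (3.11). An application of
Young's inequality yields `d/dt‖u‖_{F_0} ≤ ‖u‖³_{F_0}`"; viscosity, `2π` and the constant made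
explicit): under the hypotheses of `integral_balance` with `ν > 0`,
`F_0(t₂) + 2π²ν ∫_{t₁}^{t₂} F_2 ≤ F_0(t₁) + (2ν)⁻¹ ∫_{t₁}^{t₂} F_0³`.
[cite: RobinsonSadowskiSilva2012, §V.B Lemma 5.1, proof, p. 115618-11] -/
theorem wienerNorm_add_integral_le (hd : Fintype.card d = 3) (hν : 0 < ν) (hab : a < b)
    (h : Torus.IsClassicalNSSolutionOn (Icc a b) ν 0 u p)
    (hmean : ∀ τ ∈ Icc a b, Torus.HasZeroMean (u τ)) {t₁ t₂ : ℝ} (h₁ : a ≤ t₁) (h₁₂ : t₁ ≤ t₂)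
    (h₂ : t₂ ≤ b) :
    (∑' k : d → ℤ, ‖mFourierCoeff (EuclideanSpace.complexify ∘ u t₂) k‖) +
      2 * Real.pi ^ 2 * ν * ∫ τ in t₁..t₂, ∑' k : d → ℤ, freqNormSq k *
        ‖mFourierCoeff (EuclideanSpace.complexify ∘ u τ) k‖ ≤
    (∑' k : d → ℤ, ‖mFourierCoeff (EuclideanSpace.complexify ∘ u t₁) k‖) +
      (2 * ν)⁻¹ * ∫ τ in t₁..t₂,
        (∑' k : d → ℤ, ‖mFourierCoeff (EuclideanSpace.complexify ∘ u τ) k‖) ^ 3 := by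
  classical
  have hu := h.smooth_velocity
  have hsub : Icc t₁ t₂ ⊆ Icc a b := Icc_subset_Icc h₁ h₂
  set F0 : ℝ → ℝ := fun τ => ∑' k : d → ℤ, ‖mFourierCoeff (EuclideanSpace.complexify ∘ u τ) k‖
    with hF0
  set F1 : ℝ → ℝ := fun τ => ∑' k : d → ℤ, Real.sqrt (freqNormSq k) *
    ‖mFourierCoeff (EuclideanSpace.complexify ∘ u τ) k‖ with hF1
  set F2 : ℝ → ℝ := fun τ => ∑' k : d → ℤ, freqNormSq k *
    ‖mFourierCoeff (EuclideanSpace.complexify ∘ u τ) k‖ with hF2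
  have hR1 := integral_balance hd hν.le hab h hmean h₁ h₁₂ h₂
  -- continuity, integrability
  have hF0c : ContinuousOn F0 (Icc a b) := by
    have := continuousOn_tsum_weight_mul_norm hd hab hu hmean (φ := fun _ => (1 : ℝ))
      fun k hk => by rw [abs_one]; exact one_le_freqNormSq_of_ne_zero hk
    simpa only [one_mul] using this
  have hF1c : ContinuousOn F1 (Icc a b) :=
    continuousOn_tsum_weight_mul_norm hd hab hu hmean (φ := fun k => Real.sqrt (freqNormSq k))
      fun k hk => by
        rw [abs_of_nonneg (Real.sqrt_nonneg _)]
        exact sqrt_le_self_of_one_le (one_le_freqNormSq_of_ne_zero hk)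
  have hF2c : ContinuousOn F2 (Icc a b) :=
    continuousOn_tsum_weight_mul_norm hd hab hu hmean (φ := fun k => freqNormSq k)
      fun k _ => by rw [abs_of_nonneg (freqNormSq_nonneg _)]
  have hF2i : IntervalIntegrable F2 volume t₁ t₂ :=
    (hF2c.mono (by rw [uIcc_of_le h₁₂]; exact hsub)).intervalIntegrable
  have hF01i : IntervalIntegrable (fun τ => 2 * Real.pi * (F0 τ * F1 τ)) volume t₁ t₂ :=
    (((hF0c.mul hF1c).mono (by rw [uIcc_of_le h₁₂]; exact hsub)).intervalIntegrable).const_mul _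
  have hF03i : IntervalIntegrable (fun τ => F0 τ ^ 3) volume t₁ t₂ :=
    ((hF0c.pow 3).mono (by rw [uIcc_of_le h₁₂]; exact hsub)).intervalIntegrable
  have hYi : IntervalIntegrable (fun τ => 2 * Real.pi ^ 2 * ν * F2 τ + (2 * ν)⁻¹ * F0 τ ^ 3)
      volume t₁ t₂ := (hF2i.const_mul _).add (hF03i.const_mul _)
  -- pointwise Young step
  have hpt : ∀ τ ∈ Icc t₁ t₂, 2 * Real.pi * (F0 τ * F1 τ) ≤
      2 * Real.pi ^ 2 * ν * F2 τ + (2 * ν)⁻¹ * F0 τ ^ 3 := by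
    intro τ hτ
    have hut : IsSmooth (u τ) := hu.isSmooth_slice (hsub hτ)
    refine two_pi_mul_mul_le hν (tsum_nonneg fun k => norm_nonneg _)
      (tsum_nonneg fun k => mul_nonneg (Real.sqrt_nonneg _) (norm_nonneg _))
      (tsum_nonneg fun k => mul_nonneg (freqNormSq_nonneg _) (norm_nonneg _)) ?_
    exact sq_tsum_sqrt_mul_le (fun k => norm_nonneg _) (summable_norm hut)
      (summable_sqrt_mul_norm hut) (summable_freqNormSq_mul_norm hut)
  have hmono : ∫ τ in t₁..t₂, 2 * Real.pi * (F0 τ * F1 τ) ≤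
      ∫ τ in t₁..t₂, (2 * Real.pi ^ 2 * ν * F2 τ + (2 * ν)⁻¹ * F0 τ ^ 3) :=
    intervalIntegral.integral_mono_on h₁₂ hF01i hYi hpt
  rw [intervalIntegral.integral_const_mul, intervalIntegral.integral_add (hF2i.const_mul _)
    (hF03i.const_mul _), intervalIntegral.integral_const_mul, intervalIntegral.integral_const_mul]
    at hmono
  linarith

end Integrated

/-! ### §5 The comparison argument: `y(t₂) ≤ y(t₁) + (2ν)⁻¹∫y³` and unboundedness force
`y(t)² ≥ ν/(T − t)` -/

section Comparison

omit [Fintype d] [DecidableEq d] in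
/-- **Trapping by continuity** ("a continuity argument in the time variable", Lei–Lin 2011,
after (2.5)): if `X` is continuous on `[a, b]`, `X(a) < L`, `m < L`, and for every `t ∈ [a, b]`
the bound `X ≤ L` on `[a, t]` self-improves to `X(t) ≤ m`, then `X ≤ m` on `[a, b]`
(first crossing time of an intermediate level `c ∈ (m, L)`). [folklore] -/
private theorem forall_le_of_trap {X : ℝ → ℝ} {a b m L : ℝ} (hX : ContinuousOn X (Icc a b))
    (hmL : m < L) (ha : X a < L)
    (P : ∀ t ∈ Icc a b, (∀ τ ∈ Icc a t, X τ ≤ L) → X t ≤ m) : ∀ t ∈ Icc a b, X t ≤ m := by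
  by_contra hnot
  obtain ⟨s₀, hs₀, hs₀m⟩ : ∃ s ∈ Icc a b, m < X s := by
    simpa only [not_forall, not_le, exists_prop] using hnot
  have hab : a ≤ b := hs₀.1.trans hs₀.2
  set c : ℝ := min (X s₀) ((m + L) / 2) with hc
  have hmc : m < c := lt_min hs₀m (by linarith)
  have hcL : c < L := (min_le_right _ _).trans_lt (by linarith)
  have hcX : c ≤ X s₀ := min_le_left _ _
  -- the closed nonempty set of times where `X ≥ c`, and its infimum `t⋆`
  set S : Set ℝ := Icc a b ∩ X ⁻¹' Ici c with hS
  have hSne : S.Nonempty := ⟨s₀, hs₀, hcX⟩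
  have hSclosed : IsClosed S := hX.preimage_isClosed_of_isClosed isClosed_Icc isClosed_Ici
  have hSbdd : BddBelow S := ⟨a, fun s hs => hs.1.1⟩
  set tstar : ℝ := sInf S with htstar
  have htS : tstar ∈ S := hSclosed.csInf_mem hSne hSbdd
  have hct : c ≤ X tstar := htS.2
  have hbefore : ∀ s ∈ Ico a tstar, X s < c := by
    intro s hs
    by_contra hsc
    have hsS : s ∈ S := ⟨⟨hs.1, hs.2.le.trans htS.1.2⟩, not_lt.1 hsc⟩
    exact absurd (csInf_le hSbdd hsS) (not_le.2 hs.2)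
  -- `X(a) ≤ m < c`, so `t⋆ > a`
  have hXa : X a ≤ m := P a (left_mem_Icc.2 hab) fun τ hτ => by
    rw [le_antisymm hτ.2 hτ.1]; exact ha.le
  have hat : a < tstar := by
    rcases htS.1.1.eq_or_lt with h | h
    · exfalso; rw [← h] at hct; linarith
    · exact h
  -- left-continuity at `t⋆`: `X(t⋆) ≤ c < L`, so `X ≤ L` on `[a, t⋆]` and `P` applies there
  have hlim : X tstar ≤ c := by
    have hcw : ContinuousWithinAt X (Ico a tstar) tstar :=
      (hX tstar htS.1).mono fun s hs => ⟨hs.1, hs.2.le.trans htS.1.2⟩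
    have hmem : tstar ∈ closure (Ico a tstar) := by
      rw [closure_Ico hat.ne]; exact ⟨hat.le, le_rfl⟩
    exact ContinuousWithinAt.closure_le hmem hcw continuousWithinAt_const fun s hs =>
      (hbefore s hs).le
  have hL' : ∀ τ ∈ Icc a tstar, X τ ≤ L := by
    intro τ hτ
    rcases hτ.2.eq_or_lt with h | h
    · rw [h]; exact hlim.trans hcL.le
    · exact (hbefore τ ⟨hτ.1, h⟩).le.trans hcL.le
  have := P tstar htS.1 hL'
  linarith


omit [Fintype d] [DecidableEq d] in
/-- **ODE comparison for `ẏ ≤ y³/(2ν)` in integral form** (Robinson–Sadowski–Silva, proof of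
Lemma 5.1: "and (5.1) follows", i.e. dividing `d/dt‖u‖_{F_0} ≤ c‖u‖³_{F_0}` by `‖u‖³_{F_0}` and
integrating up to the blow-up time; here, `y` being only continuous, by comparison with the
explicit solution `z(s) = (m⁻² − (s − t)/ν)^{−1/2}` of `ż = z³/(2ν)`, `z(t) = m > y(t)`, and a
first-crossing argument). If `y ≥ 0` is continuous on `[a, T)`, satisfies
`y(t₂) ≤ y(t₁) + (2ν)⁻¹∫_{t₁}^{t₂} y³` for `a ≤ t₁ ≤ t₂ < T`, and is unbounded on `[a, T)`, then
`ν/(T − t) ≤ y(t)²` for every `t ∈ [a, T)`. [folklore] -/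
private theorem div_le_sq_of_integral_ineq {y : ℝ → ℝ} {a T ν : ℝ} (hν : 0 < ν)
    (hyc : ContinuousOn y (Ico a T)) (hy0 : ∀ s ∈ Ico a T, 0 ≤ y s)
    (hint : ∀ ⦃t₁ t₂ : ℝ⦄, a ≤ t₁ → t₁ ≤ t₂ → t₂ < T →
      y t₂ ≤ y t₁ + (2 * ν)⁻¹ * ∫ τ in t₁..t₂, y τ ^ 3)
    (hunb : ¬ BddAbove (y '' Ico a T)) {t : ℝ} (ht : t ∈ Ico a T) :
    ν / (T - t) ≤ y t ^ 2 := by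
  by_contra hlt
  rw [not_le] at hlt
  have hν0 : ν ≠ 0 := hν.ne'
  have hTt : 0 < T - t := sub_pos.2 ht.2
  set L : ℝ := ν / (T - t) with hL
  have hyt : 0 ≤ y t := hy0 t ht
  -- an intermediate level `m`: `y(t) < m`, `m² < L`
  have hys : y t < Real.sqrt L := (Real.lt_sqrt hyt).2 hlt
  set m : ℝ := (y t + Real.sqrt L) / 2 with hm
  have hym : y t < m := by rw [hm]; linarith
  have hm0 : 0 < m := lt_of_le_of_lt hyt hym
  have hmL : m ^ 2 < L := (Real.lt_sqrt hm0.le).1 (by rw [hm]; linarith)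
  have hmT : m ^ 2 * (T - t) < ν := (lt_div_iff₀ hTt).1 hmL
  -- the comparison function `z(s) = (√(m⁻² − (s − t)/ν))⁻¹`, finite on `[t, T]`
  set base : ℝ → ℝ := fun s => (m ^ 2)⁻¹ - (s - t) / ν with hbase
  have hB : 0 < (m ^ 2)⁻¹ - (T - t) / ν := by
    rw [sub_pos, div_lt_iff₀ hν, inv_mul_eq_div, lt_div_iff₀ (pow_pos hm0 2)]
    linarith
  have hbase_eq : ∀ s, base s = ((m ^ 2)⁻¹ - (T - t) / ν) + (T - s) / ν := by
    intro s
    simp only [hbase]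
    field_simp
    ring
  have hbase_pos : ∀ s, s ≤ T → 0 < base s := fun s hs => by
    rw [hbase_eq s]
    exact add_pos_of_pos_of_nonneg hB (div_nonneg (sub_nonneg.2 hs) hν.le)
  set z : ℝ → ℝ := fun s => (Real.sqrt (base s))⁻¹ with hz
  have hzt : z t = m := by
    simp only [hz, hbase, sub_self, zero_div, sub_zero, Real.sqrt_inv, inv_inv]
    exact Real.sqrt_sq hm0.le
  have hzle : ∀ s, s ≤ T → z s ≤ (Real.sqrt ((m ^ 2)⁻¹ - (T - t) / ν))⁻¹ := by
    intro s hs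
    refine inv_anti₀ (Real.sqrt_pos.2 hB) (Real.sqrt_le_sqrt ?_)
    rw [hbase_eq s]
    linarith [div_nonneg (sub_nonneg.2 hs) hν.le]
  have hbc : Continuous base :=
    continuous_const.sub ((continuous_id.sub continuous_const).div_const ν)
  have hzc : ContinuousOn z (Icc t T) :=
    ContinuousOn.inv₀ hbc.continuousOn.sqrt fun s hs => (Real.sqrt_pos.2 (hbase_pos s hs.2)).ne'
  have hzd : ∀ s, s ≤ T → HasDerivAt z ((2 * ν)⁻¹ * z s ^ 3) s := by
    intro s hs
    have hb0 := hbase_pos s hs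
    have hsq0 : Real.sqrt (base s) ≠ 0 := (Real.sqrt_pos.2 hb0).ne'
    have h1 : HasDerivAt base (-(1 / ν)) s :=
      (((hasDerivAt_id' s).sub_const t).div_const ν).const_sub ((m ^ 2)⁻¹)
    have h2 := (h1.sqrt hb0.ne').inv hsq0
    refine h2.congr_deriv ?_
    simp only [hz]
    field_simp
  have hFTC : ∀ s₀, t ≤ s₀ → s₀ ≤ T →
      (2 * ν)⁻¹ * ∫ τ in t..s₀, z τ ^ 3 = z s₀ - z t := by
    intro s₀ h1 h2
    rw [← intervalIntegral.integral_const_mul]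
    refine intervalIntegral.integral_eq_sub_of_hasDerivAt (fun τ hτ => hzd τ ?_) ?_
    · rw [uIcc_of_le h1] at hτ
      exact hτ.2.trans h2
    · exact ((continuousOn_const.mul (hzc.pow 3)).mono (by
        rw [uIcc_of_le h1]; exact Icc_subset_Icc_right h2)).intervalIntegrable
  -- `y ≤ z − (m − y(t))` on `[t, T)` by trapping
  have htrap : ∀ s ∈ Ico t T, y s ≤ z s - (m - y t) := by
    intro s₁ hs₁
    have hIcc : Icc t s₁ ⊆ Ico a T := fun s hs => ⟨ht.1.trans hs.1, hs.2.trans_lt hs₁.2⟩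
    have hX : ContinuousOn (fun s => y s - z s) (Icc t s₁) :=
      (hyc.mono hIcc).sub (hzc.mono (Icc_subset_Icc_right hs₁.2.le))
    have key := forall_le_of_trap (X := fun s => y s - z s) (m := -(m - y t)) (L := 0) hX
      (by linarith) (by simp only [hzt]; linarith) ?_ s₁ (right_mem_Icc.2 hs₁.1)
    · linarith
    intro s hs hle
    have hsT : s < T := hs.2.trans_lt hs₁.2
    have hIcc' : Icc t s ⊆ Ico a T := fun τ hτ => ⟨ht.1.trans hτ.1, hτ.2.trans_lt hsT⟩
    have hy3i : IntervalIntegrable (fun τ => y τ ^ 3) volume t s :=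
      (((hyc.mono hIcc').pow 3).mono (by rw [uIcc_of_le hs.1])).intervalIntegrable
    have hz3i : IntervalIntegrable (fun τ => z τ ^ 3) volume t s :=
      (((hzc.mono (Icc_subset_Icc_right hsT.le)).pow 3).mono
        (by rw [uIcc_of_le hs.1])).intervalIntegrable
    have hmono : ∫ τ in t..s, y τ ^ 3 ≤ ∫ τ in t..s, z τ ^ 3 :=
      intervalIntegral.integral_mono_on hs.1 hy3i hz3i fun τ hτ =>
        pow_le_pow_left₀ (hy0 τ (hIcc' hτ)) (by linarith [hle τ hτ]) 3
    have h1 := hint ht.1 hs.1 hsT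
    have h2 := hFTC s hs.1 hsT.le
    have h3 : (2 * ν)⁻¹ * ∫ τ in t..s, y τ ^ 3 ≤ (2 * ν)⁻¹ * ∫ τ in t..s, z τ ^ 3 :=
      mul_le_mul_of_nonneg_left hmono (by positivity)
    linarith
  -- hence `y` is bounded on `[a, T)`: contradiction
  obtain ⟨K, hK⟩ := isCompact_Icc.bddAbove_image
    (hyc.mono (fun s hs => ⟨hs.1, hs.2.trans_lt ht.2⟩ : Icc a t ⊆ Ico a T))
  refine hunb ⟨max K ((Real.sqrt ((m ^ 2)⁻¹ - (T - t) / ν))⁻¹), ?_⟩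
  rintro _ ⟨s, hs, rfl⟩
  rcases le_or_gt s t with hst | hst
  · exact (hK ⟨s, ⟨hs.1, hst⟩, rfl⟩).trans (le_max_left _ _)
  · have := htrap s ⟨hst.le, hs.2⟩
    have h' := hzle s hs.2.le
    have : y s ≤ (Real.sqrt ((m ^ 2)⁻¹ - (T - t) / ν))⁻¹ := by linarith
    exact this.trans (le_max_right _ _)

end Comparison

end NSWiener

/-! ### §6 Robinson–Sadowski–Silva's Lemma 5.1 on `T³`: the `F_0` blow-up rate -/

section Rate

open Literature.Analysis.FunctionSpaces Literature.Analysis.FunctionSpaces.Torus NSGevrey NSSobolev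
open NSWiener

variable {d : Type*} [Fintype d] [DecidableEq d]

/-- **Robinson–Sadowski–Silva 2012, Lemma 5.1 (after Benameur 2010) — blow-up rate in the Wiener
algebra `F_0`, on `T³`.** "If we want to obtain the 'optimal rate' in the periodic case in a space
that has the same scaling as `Ḣ^{3/2}`, we can follow Benameur (2010) and consider blowup in
`F_0(Q)`. Lemma 5.1. There exists an absolute constant `c_{3/2}` such that
`‖u(T − t)‖_{F_0(Q)} ≥ c_{3/2} t^{−1/2}`" (`‖u‖_{F_0} = ∑_k|û(k)|`, §III (3.1); `T` the blow-up
time, `ν = 1`). Here, in the tree's classical vocabulary on the unit torus `T^d`, `card d = 3`,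
with the viscosity restored and the constant explicit: for a classical solution of the unforced
Navier–Stokes equations with `ν > 0` on `[a, T) × T^d` with mean-zero velocity slices whose Wiener
norm `t ↦ ∑_k ‖û(t, k)‖` is UNBOUNDED on `[a, T)`,
`∑_k ‖û(t, k)‖ ≥ (ν/(T − t))^{1/2}` for every `t ∈ [a, T)`
(`wienerNorm_add_integral_le` and the comparison argument `div_le_sq_of_integral_ineq`).
[cite: RobinsonSadowskiSilva2012, §V.B Lemma 5.1 (5.1), p. 115618-11] -/
theorem Torus.wienerNorm_blowup_rate (hd : Fintype.card d = 3) {ν a T : ℝ} (hν : 0 < ν)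
    {u : ℝ → UnitAddTorus d → EuclideanSpace ℝ d} {p : ℝ → UnitAddTorus d → ℝ}
    (h : Torus.IsClassicalNSSolutionOn (Ico a T) ν 0 u p)
    (hmean : ∀ t ∈ Ico a T, Torus.HasZeroMean (u t))
    (hunb : ¬ BddAbove ((fun t => ∑' k : d → ℤ,
      ‖mFourierCoeff (EuclideanSpace.complexify ∘ u t) k‖) '' Ico a T)) :
    ∀ t ∈ Ico a T, Real.sqrt (ν / (T - t)) ≤
      ∑' k : d → ℤ, ‖mFourierCoeff (EuclideanSpace.complexify ∘ u t) k‖ := by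
  intro t ht
  set y : ℝ → ℝ := fun s => ∑' k : d → ℤ, ‖mFourierCoeff (EuclideanSpace.complexify ∘ u s) k‖
    with hy
  -- closed windows `[a, t'] ⊂ [a, T)`
  have hW : ∀ {t' : ℝ}, a < t' → t' < T →
      Torus.IsClassicalNSSolutionOn (Icc a t') ν 0 u p ∧ ∀ τ ∈ Icc a t', Torus.HasZeroMean (u τ) :=
    fun {t'} h1 h2 => ⟨h.mono (Icc_subset_Ico_right h2) (uniqueDiffOn_Icc h1),
      fun τ hτ => hmean τ ⟨hτ.1, hτ.2.trans_lt h2⟩⟩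
  have hyc : ContinuousOn y (Ico a T) := by
    intro s hs
    have h1 : a < (s + T) / 2 := by linarith [hs.1, hs.2]
    have h2 : (s + T) / 2 < T := by linarith [hs.2]
    obtain ⟨hw, hwm⟩ := hW h1 h2
    have hc := continuousOn_tsum_weight_mul_norm hd h1 hw.smooth_velocity hwm
      (φ := fun _ => (1 : ℝ)) fun k hk => by rw [abs_one]; exact one_le_freqNormSq_of_ne_zero hk
    simp only [one_mul] at hc
    refine (hc s ⟨hs.1, by linarith [hs.2]⟩).mono_of_mem_nhdsWithin ?_
    exact mem_nhdsWithin.2 ⟨Iio ((s + T) / 2), isOpen_Iio,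
      by simp only [Set.mem_Iio]; linarith [hs.2], fun x hx => ⟨hx.2.1, (Set.mem_Iio.1 hx.1).le⟩⟩
  have hy0 : ∀ s ∈ Ico a T, 0 ≤ y s := fun s _ => tsum_nonneg fun k => norm_nonneg _
  have hint : ∀ ⦃t₁ t₂ : ℝ⦄, a ≤ t₁ → t₁ ≤ t₂ → t₂ < T →
      y t₂ ≤ y t₁ + (2 * ν)⁻¹ * ∫ τ in t₁..t₂, y τ ^ 3 := by
    intro t₁ t₂ h1 h12 h2T
    have hb1 : a < (t₂ + T) / 2 := by linarith
    have hb2 : (t₂ + T) / 2 < T := by linarith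
    obtain ⟨hw, hwm⟩ := hW hb1 hb2
    have hR2 := wienerNorm_add_integral_le hd hν hb1 hw hwm h1 h12
      (by linarith : t₂ ≤ (t₂ + T) / 2)
    have hF2 : 0 ≤ ∫ τ in t₁..t₂, ∑' k : d → ℤ, freqNormSq k *
        ‖mFourierCoeff (EuclideanSpace.complexify ∘ u τ) k‖ :=
      intervalIntegral.integral_nonneg h12 fun τ _ =>
        tsum_nonneg fun k => mul_nonneg (freqNormSq_nonneg _) (norm_nonneg _)
    have hpos : 0 ≤ 2 * Real.pi ^ 2 * ν * ∫ τ in t₁..t₂, ∑' k : d → ℤ, freqNormSq k *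
        ‖mFourierCoeff (EuclideanSpace.complexify ∘ u τ) k‖ := by positivity
    simp only [hy]
    linarith
  have key := div_le_sq_of_integral_ineq hν hyc hy0 hint hunb ht
  calc Real.sqrt (ν / (T - t)) ≤ Real.sqrt (y t ^ 2) := Real.sqrt_le_sqrt key
    _ = y t := Real.sqrt_sq (hy0 t ht)

/-- **`F_0 ⊂ L^∞` and Serrin: a bounded Wiener norm continues the solution.** A classical solution
of the unforced Navier–Stokes equations on `[0, T) × T³` (`ν > 0`, `T > 0`, mean-zero slices)
whose Wiener norm `∑_k‖û(t,k)‖` is BOUNDED on `[0, T)` continues to a classical solution with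
mean-zero slices on some `[0, T'] × T³`, `T' > T`, equal to `u` on `[0, T)`:
`‖u(t)‖_∞ ≤ ∑_k‖û(t,k)‖` (`F_0 ⊂ L^∞`, Robinson–Sadowski–Silva (3.2);
`Torus.norm_le_tsum_norm_mFourierCoeff`) feeds Serrin's criterion at `s = ∞`, `r = 2`
(`Torus.classicalNS_continuation_of_velocitySup_sq_integral_le`, RRS 2016 Thm 8.17).
[cite: RobinsonSadowskiSilva2012, §III (3.2), p. 115618-6;
RobinsonRodrigoSadowskiCUP2016, Thm 8.17 with Lemma 8.16] -/
theorem Torus.classicalNS_continuation_of_bddAbove_wienerNorm (hd : Fintype.card d = 3)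
    {ν T : ℝ} (hν : 0 < ν) (hT : 0 < T)
    {u : ℝ → UnitAddTorus d → EuclideanSpace ℝ d} {p : ℝ → UnitAddTorus d → ℝ}
    (h : Torus.IsClassicalNSSolutionOn (Ico 0 T) ν 0 u p)
    (hmean : ∀ t ∈ Ico 0 T, Torus.HasZeroMean (u t))
    (hbdd : BddAbove ((fun t => ∑' k : d → ℤ,
      ‖mFourierCoeff (EuclideanSpace.complexify ∘ u t) k‖) '' Ico 0 T)) :
    ∃ T' : ℝ, T < T' ∧ ∃ (u' : ℝ → UnitAddTorus d → EuclideanSpace ℝ d)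
      (p' : ℝ → UnitAddTorus d → ℝ), Torus.IsClassicalNSSolutionOn (Icc 0 T') ν 0 u' p' ∧
        (∀ t ∈ Icc 0 T', Torus.HasZeroMean (u' t)) ∧ ∀ t ∈ Ico 0 T, u' t = u t := by
  obtain ⟨M, hM⟩ := hbdd
  have hM0 : 0 ≤ M :=
    le_trans (tsum_nonneg fun k => norm_nonneg _) (hM ⟨0, ⟨le_rfl, hT⟩, rfl⟩)
  have hN : ∀ t ∈ Ico 0 T, ∀ x, ‖u t x‖ ≤ M := fun t ht x =>
    (norm_le_tsum_norm_mFourierCoeff (h.smooth_velocity.isSmooth_slice ht) x).trans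
      (hM ⟨t, ht, rfl⟩)
  have hI : ∀ t ∈ Ico 0 T, ∫ s in (0 : ℝ)..t, (fun _ : ℝ => M) s ^ 2 ≤ T * M ^ 2 := by
    intro t ht
    simp only [intervalIntegral.integral_const, smul_eq_mul, sub_zero]
    exact mul_le_mul_of_nonneg_right ht.2.le (sq_nonneg _)
  exact Torus.classicalNS_continuation_of_velocitySup_sq_integral_le hd hν hT h hmean
    (N := fun _ => M) continuousOn_const (fun _ _ => hM0) hN hI

/-- **Blow-up read off the enstrophy.** A classical solution of the unforced Navier–Stokes
equations on `[0, T) × T³` (`ν > 0`, `T > 0`, mean-zero slices) whose enstrophy `‖∇u(t)‖₂²` is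
UNBOUNDED on `[0, T)` has its Wiener norm `∑_k‖û(t,k)‖` unbounded on `[0, T)` as well: otherwise
`Torus.classicalNS_continuation_of_bddAbove_wienerNorm` continues the solution to a classical one
on `[0, T']`, `T' > T`, whose enstrophy is bounded on the compact `[0, T]`.
[cite: RobinsonSadowskiSilva2012, §III (3.2), p. 115618-6;
RobinsonRodrigoSadowskiCUP2016, Thm 8.17 with Lemma 8.16] -/
theorem Torus.not_bddAbove_wienerNorm_of_not_bddAbove_gradNormSq (hd : Fintype.card d = 3)
    {ν T : ℝ} (hν : 0 < ν) (hT : 0 < T)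
    {u : ℝ → UnitAddTorus d → EuclideanSpace ℝ d} {p : ℝ → UnitAddTorus d → ℝ}
    (h : Torus.IsClassicalNSSolutionOn (Ico 0 T) ν 0 u p)
    (hmean : ∀ t ∈ Ico 0 T, Torus.HasZeroMean (u t))
    (hunb : ¬ BddAbove ((fun t => Torus.gradNormSq (u t)) '' Ico 0 T)) :
    ¬ BddAbove ((fun t => ∑' k : d → ℤ,
      ‖mFourierCoeff (EuclideanSpace.complexify ∘ u t) k‖) '' Ico 0 T) := by
  intro hbdd
  obtain ⟨T', hTT', u', p', h', -, hagree⟩ :=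
    Torus.classicalNS_continuation_of_bddAbove_wienerNorm hd hν hT h hmean hbdd
  -- the continuation has bounded enstrophy on `[0, T]`, contradiction
  have hcont : ContinuousOn (fun t => Torus.gradNormSq (u' t)) (Icc 0 T') :=
    h'.smooth_velocity.continuousOn_gradNormSq (convex_Icc 0 T') (uniqueDiffOn_Icc (hT.trans hTT'))
  obtain ⟨K, hK⟩ := (isCompact_Icc.image_of_continuousOn hcont).isBounded.bddAbove
  refine hunb ⟨K, ?_⟩
  rintro _ ⟨t, ht, rfl⟩
  have hmem : t ∈ Icc 0 T' := ⟨ht.1, ht.2.le.trans hTT'.le⟩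
  have := hK ⟨t, hmem, rfl⟩
  simpa [hagree t ht] using this

/-- **The Wiener-algebra lifespan bound** (Robinson–Sadowski–Silva 2012, after Lemma 5.1: "a
lower bound on the existence time `T ∼ ‖û₀‖_{ℓ¹}^{−2}`, and hence (5.1)" — there on `ℝ³` via the
mild formulation; here on `T³` as the `t = 0` instance of `Torus.wienerNorm_blowup_rate`, with the
constant explicit): a classical solution of the unforced Navier–Stokes equations (`ν > 0`) on
`[0, T) × T³`, `T > 0`, with mean-zero slices and `T · (∑_k‖û(0,k)‖)² < ν` has its Wiener norm
bounded on `[0, T)` and continues to a classical solution with mean-zero slices on some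
`[0, T'] × T³`, `T' > T`, equal to `u` on `[0, T)` — no blow-up before `ν/F_0(u(0))²`.
[cite: RobinsonSadowskiSilva2012, §V.B Lemma 5.1 and p. 115618-12 (lifespan remark)] -/
theorem Torus.classicalNS_continuation_of_wienerNorm_lifespan (hd : Fintype.card d = 3)
    {ν T : ℝ} (hν : 0 < ν) (hT : 0 < T)
    {u : ℝ → UnitAddTorus d → EuclideanSpace ℝ d} {p : ℝ → UnitAddTorus d → ℝ}
    (h : Torus.IsClassicalNSSolutionOn (Ico 0 T) ν 0 u p)
    (hmean : ∀ t ∈ Ico 0 T, Torus.HasZeroMean (u t))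
    (hsmall : T * (∑' k : d → ℤ, ‖mFourierCoeff (EuclideanSpace.complexify ∘ u 0) k‖) ^ 2 < ν) :
    ∃ T' : ℝ, T < T' ∧ ∃ (u' : ℝ → UnitAddTorus d → EuclideanSpace ℝ d)
      (p' : ℝ → UnitAddTorus d → ℝ), Torus.IsClassicalNSSolutionOn (Icc 0 T') ν 0 u' p' ∧
        (∀ t ∈ Icc 0 T', Torus.HasZeroMean (u' t)) ∧ ∀ t ∈ Ico 0 T, u' t = u t := by
  refine Torus.classicalNS_continuation_of_bddAbove_wienerNorm hd hν hT h hmean ?_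
  by_contra hunb
  have h0 : (0 : ℝ) ∈ Ico 0 T := ⟨le_rfl, hT⟩
  have hrate := Torus.wienerNorm_blowup_rate hd hν h hmean hunb 0 h0
  rw [sub_zero] at hrate
  have hF0 : 0 ≤ ∑' k : d → ℤ, ‖mFourierCoeff (EuclideanSpace.complexify ∘ u 0) k‖ :=
    tsum_nonneg fun k => norm_nonneg _
  have hsq : ν / T ≤ (∑' k : d → ℤ, ‖mFourierCoeff (EuclideanSpace.complexify ∘ u 0) k‖) ^ 2 := by
    calc ν / T = Real.sqrt (ν / T) ^ 2 := (Real.sq_sqrt (div_nonneg hν.le hT.le)).symm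
      _ ≤ _ := pow_le_pow_left₀ (Real.sqrt_nonneg _) hrate 2
  rw [div_le_iff₀ hT] at hsq
  linarith

/-- **Robinson–Sadowski–Silva 2012, Lemma 5.1, enstrophy reading of blow-up, on `T³`.** For every
classical solution of the unforced Navier–Stokes equations (`ν > 0`) on `[0, T) × T^d`,
`card d = 3`, `T > 0`, with mean-zero velocity slices whose enstrophy `‖∇u(t)‖₂²` is unbounded on
`[0, T)` (no classical continuation past `T`, RRS 2016 Lemma 6.11),
`∑_k ‖û(t, k)‖ ≥ (ν/(T − t))^{1/2}` for all `t ∈ [0, T)` — the rate `t^{−1/2}` of a space with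
the scaling of `Ḣ^{3/2}`. [cite: RobinsonSadowskiSilva2012, §V.B Lemma 5.1 (5.1), p. 115618-11] -/
theorem Torus.wienerNorm_blowup_rate_of_not_bddAbove_gradNormSq (hd : Fintype.card d = 3)
    {ν T : ℝ} (hν : 0 < ν) (hT : 0 < T)
    {u : ℝ → UnitAddTorus d → EuclideanSpace ℝ d} {p : ℝ → UnitAddTorus d → ℝ}
    (h : Torus.IsClassicalNSSolutionOn (Ico 0 T) ν 0 u p)
    (hmean : ∀ t ∈ Ico 0 T, Torus.HasZeroMean (u t))
    (hunb : ¬ BddAbove ((fun t => Torus.gradNormSq (u t)) '' Ico 0 T)) :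
    ∀ t ∈ Ico 0 T, Real.sqrt (ν / (T - t)) ≤
      ∑' k : d → ℤ, ‖mFourierCoeff (EuclideanSpace.complexify ∘ u t) k‖ :=
  Torus.wienerNorm_blowup_rate hd hν h hmean
    (Torus.not_bddAbove_wienerNorm_of_not_bddAbove_gradNormSq hd hν hT h hmean hunb)

end Rate

end Literature.Analysis.FluidPDE

end
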